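import Literature.Computability.MetaComplexity.TseitinDepthFregeWallLowerBound
import Literature.Computability.MetaComplexity.TseitinDepthFregeExcludedGrid
import HarnessLib

/-!
# GIRS Theorem 18 from Håstad's TORUS theorem: the embedding of the torus into the grid

[topic Computability/MetaComplexity]

The conditional discharge of
`Literature.Computability.MetaComplexity.galesiEtAl_tseitin_treewidth_depthFrege_lowerBound`
(Galesi–Itsykson–Riazanov–Sofronova, APAL 2023, Thm. 18; `TseitinDepthFrege.lean`) in
`TseitinDepthFregeProofs.lean` / `TseitinDepthFregeExcludedGrid.lean` takes the proof-complexity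
input in the form (H) of GIRS Thm. 17: a lower bound for the Tseitin formulas `T(𝓗_{n,n}, f)` of the
PLANAR grid with ARBITRARY charges. Its primary source, Håstad's theorem (J. ACM 68 (2021), Thm. 6.5;
ECCC TR17-142), is stated and proved for the `n × n` TORUS, `n` odd, all charges `1` ("We have a
graph `G` which we call 'the grid' but to avoid problems at the perimeter we in fact use the torus",
§2), the grid case being a remark of its concluding section: "the result applies to the grid graph as
… it is possible to embed the `n × n` torus in a `(2n+3) × (2n+2)` grid. The wrap around edges are
mapped to paths of full length running between the vertices of the torus that are mapped in the
natural way to nodes with both coordinates even." This file PROVES that remark in the tree's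
vocabulary, so that GIRS Theorem 18 becomes conditional on Håstad's theorem exactly as printed
(`galesiEtAl_tseitin_treewidth_depthFrege_lowerBound_of_hastadTorus_of_chuzhoyTan`):

1. `torusSystem n` — the Tseitin contradiction of the torus `C_n × C_n` (one `𝔽₂`-variable per
   edge, charge `1` at every vertex), `sumEncoding 1 (torusSystem n)` its 4-CNF.
2. **The embedding** (`TorusEmbedding`): torus vertex `(a, b)` sits at the cell `(2a+1, 2b+1)` of
   `𝓗_{k,k}` (`k ≥ 2n+1`); the edge `(a,b) — (a+1,b)` is the path of length two through
   `(2a+2, 2b+1)` and, for `a = n-1`, the wrap-around path down column `2b+1` into the frame row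
   `2n+1`, up the whole even column `2b+2` (crossing everything) into the frame row `0` and back;
   symmetrically in the other coordinate. The paths are edge-disjoint and cross only at cells of
   degree four, which Tseitin substitutions tolerate. We never handle paths as such: the embedding
   is the LABELLING `teV` / `teH` of the grid edges by (codes of) torus edges, and all that is needed
   about it is the **incidence identity** `cellSum_eq`: at every cell the labels of the four
   incident edges cancel in pairs, except at a torus cell `(2a+1, 2b+1)`, where they are the four
   torus edges at `(a, b)` — a finite case analysis on the parities and the frame.
3. **The substitution** `σ` (`TorusEmbedding.subst`): a grid edge on the path of the torus edge `e`
   gets the literal `x_e ⊕ β`, every other edge the constant `β`, where the bits `β` are the routing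
   `GridLabel.cbit` (a `T`-join, `GridTseitinDepthFregeLowerBound.lean`) of the demand
   "charge `+` indicator of the torus cells", of total `Σ f + n² = 1 + 1 = 0`. Then every substituted
   parity block of `T(𝓗_{k,k}, f)` is a tautology off the torus cells and is equivalent to the torus
   row of `(a, b)` at the torus cell `(2a+1, 2b+1)` (`gridRow_holds_iff`), so the transfer lemma
   (GIRS Lemma 10, `TextbookFrege.transfer_isDepthProofOf`) turns a depth-`d` refutation of
   `T(𝓗_{k,k}, f)` into a depth-`(d+17)` refutation of the torus contradiction of cubic size
   (`exists_torusRefutation`).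
4. **Presentations** (`exists_gridSystemRefutation`): any `E` with `IsGridTseitinSystem k E` reduces
   to the canonical `gridSystem k f` by a renaming (transfer, depth `+16`).
5. **Assembly** with explicit thresholds (`TseitinNumerics`): (H_T) Håstad's torus theorem ⇒ the
   per-depth torus form ⇒ the canonical grid form ⇒ the grid form (H′) of
   `galesiEtAl_tseitin_treewidth_depthFrege_lowerBound_of_grid_of_wall`; hence GIRS Thm. 18 from
   (H_T) and the Excluded Grid Theorem (Chuzhoy–Tan Thm. 1.1, or any polynomial version, or the
   wall form).

All statements are proved; no new facts. (H_T) is spelled out as a hypothesis, in the tree's Frege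
formalism `textbookFrege` / `altDepth`, with Håstad's constants `1/59`, `1/(58(d+1))` and base `e`
absorbed into `K, c, n₀` — as the `O(1)` depth shifts between Frege formalisms require anyway
(GIRS Lemma 3, App. A).

## References

* [Hastad2020] J. Håstad, *On small-depth Frege proofs for Tseitin for grids*, J. ACM 68 (1)
  (2021) art. 1 (FOCS 2017). Read: ECCC TR17-142 rev. 1, §2 (p. 5: the torus, charges, Lemma 2.1),
  Thm. 6.5 (p. 19), §8 "Final words" (pp. 32–33: the embedding of the torus in the grid).
* [GalesiEtAl2023] N. Galesi, D. Itsykson, A. Riazanov, A. Sofronova, *Bounded-depth Frege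
  complexity of Tseitin formulas for all graphs*, Ann. Pure Appl. Logic 174 (2023) 103166, Lemma 10,
  Lemmas 11–16 (the pattern of the reduction), Thm. 17, Thm. 18 and §3.3. Read: APAL pp. 10–16.
* [ChuzhoyTan2021] J. Chuzhoy, Z. Tan, *Towards tight(er) bounds for the Excluded Grid Theorem*,
  J. Combin. Theory Ser. B 146 (2021) 219–265, Thm. 1.1.
-/

namespace Literature.Computability.MetaComplexity

open Finset Literature.Combinatorics.SimpleGraph Complexity Complexity.PropForm TextbookFrege

/-! ### The torus Tseitin contradiction -/

/-- The edges of the `n × n` torus `C_n × C_n` on the vertices `(a, b) ∈ ℤ_n × ℤ_n`: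
`Sum.inl (a, b)` is the edge `(a, b) — (a+1, b)` and `Sum.inr (a, b)` the edge `(a, b) — (a, b+1)`
(indices mod `n`). [cite: Hastad2020, §2 ("a node (i,j) is connected to the four nodes at
distance 1 … modulo n")] -/
abbrev TorusEdge (n : ℕ) : Type := (Fin n × Fin n) ⊕ (Fin n × Fin n)

/-- The two ends of a torus edge. [cite: Hastad2020, §2] -/
def torusEnds {n : ℕ} : TorusEdge n → (Fin n × Fin n) × (Fin n × Fin n)
  | Sum.inl (a, b) => ((a, b), (finRotate n a, b))
  | Sum.inr (a, b) => ((a, b), (a, finRotate n b))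

/-- Ends of an edge in the first direction. [folklore] -/
@[simp] theorem torusEnds_inl {n : ℕ} (a b : Fin n) :
    torusEnds (Sum.inl (a, b) : TorusEdge n) = ((a, b), (finRotate n a, b)) := rfl

/-- Ends of an edge in the second direction. [folklore] -/
@[simp] theorem torusEnds_inr {n : ℕ} (a b : Fin n) :
    torusEnds (Sum.inr (a, b) : TorusEdge n) = ((a, b), (a, finRotate n b)) := rfl

/-- **The Tseitin contradiction of the `n × n` torus** (Håstad's "Tseitin contradictions on the
grid"): one `𝔽₂`-variable per torus edge, one equation per torus vertex `w`, the coefficient of the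
variable of the edge `e` in the row of `w` being the number of ends of `e` at `w` (mod `2`), and
every right-hand side (charge) equal to `1`; rows and variables are numbered by `Fintype.equivFin`.
Its Boolean encoding is `sumEncoding 1 (torusSystem n)` ("8 clauses of length four for each node").
For `n` odd it is unsatisfiable (`n²` odd charges). [cite: Hastad2020, §2 (Tseitin formulas;
"the Tseitin contradictions is when α_v = 1 for each v")] -/
noncomputable def torusSystem (n : ℕ) :
    Fin (Fintype.card (Fin n × Fin n)) → LinEqMod 2 (Fintype.card (TorusEdge n)) :=
  fun i =>
    (fun j =>
      (if (torusEnds ((Fintype.equivFin (TorusEdge n)).symm j)).1 = (Fintype.equivFin _).symm i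
        then 1 else 0) +
      (if (torusEnds ((Fintype.equivFin (TorusEdge n)).symm j)).2 = (Fintype.equivFin _).symm i
        then 1 else 0),
     1)

/-- Every charge of the torus contradiction is `1`. [cite: Hastad2020, §2] -/
@[simp] theorem torusSystem_snd (n : ℕ) (i) : (torusSystem n i).2 = 1 := rfl

/-- The index of the variable of a torus edge. [folklore] -/
noncomputable def ti (n : ℕ) (e : TorusEdge n) : ℕ := (Fintype.equivFin (TorusEdge n) e : ℕ)

/-- `ti` is injective. [folklore] -/
theorem ti_injective (n : ℕ) : Function.Injective (ti n) := fun _ _ h =>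
  (Fintype.equivFin (TorusEdge n)).injective (Fin.ext h)

/-- The edges whose first end is `w`. [folklore] -/
def fstEdges {n : ℕ} (w : Fin n × Fin n) : Finset (TorusEdge n) :=
  univ.filter fun e => (torusEnds e).1 = w

/-- The edges whose second end is `w`. [folklore] -/
def sndEdges {n : ℕ} (w : Fin n × Fin n) : Finset (TorusEdge n) :=
  univ.filter fun e => (torusEnds e).2 = w

/-- The coefficient of the variable of the torus edge `e` in the row of the vertex `w`.
[cite: Hastad2020, §2] -/
theorem torusSystem_coeff {n : ℕ} (w : Fin n × Fin n) (e : TorusEdge n) :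
    (torusSystem n (Fintype.equivFin _ w)).1 (Fintype.equivFin _ e) =
      (if (torusEnds e).1 = w then 1 else 0) + (if (torusEnds e).2 = w then 1 else 0) := by
  simp only [torusSystem, Equiv.symm_apply_apply]

/-- The left-hand side of the row of `w` under values `z`: the sum over the edges with first end
`w` plus the sum over the edges with second end `w`. [folklore] -/
theorem torusSystem_rowSum {n : ℕ} (w : Fin n × Fin n) (z : Fin (Fintype.card (TorusEdge n)) → ZMod 2) :
    ∑ j, (torusSystem n (Fintype.equivFin _ w)).1 j * z j =
      ∑ e ∈ fstEdges w, z (Fintype.equivFin _ e) + ∑ e ∈ sndEdges w, z (Fintype.equivFin _ e) := by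
  rw [← Equiv.sum_comp (Fintype.equivFin (TorusEdge n))]
  simp only [torusSystem_coeff, add_mul, ite_mul, one_mul, zero_mul, Finset.sum_add_distrib]
  rw [fstEdges, sndEdges, Finset.sum_filter, Finset.sum_filter]

/-- The edges with first end `w = (a, b)` are `inl (a, b)` and `inr (a, b)`. [folklore] -/
theorem sum_fstEdges {n : ℕ} {M : Type*} [AddCommMonoid M] (F : TorusEdge n → M) (w : Fin n × Fin n) :
    ∑ e ∈ fstEdges w, F e = F (Sum.inl w) + F (Sum.inr w) := by
  classical
  have h : fstEdges w = {Sum.inl w, Sum.inr w} := by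
    ext e
    rw [fstEdges, Finset.mem_filter, Finset.mem_insert, Finset.mem_singleton]
    rcases e with ⟨a, b⟩ | ⟨a, b⟩ <;> obtain ⟨a', b'⟩ := w <;> simp [Prod.ext_iff]
  rw [h, Finset.sum_pair (by simp)]

/-- The edges with second end `w = (a, b)` are `inl (a-1, b)` and `inr (a, b-1)`. [folklore] -/
theorem sum_sndEdges {n : ℕ} {M : Type*} [AddCommMonoid M] (F : TorusEdge n → M) (w : Fin n × Fin n) :
    ∑ e ∈ sndEdges w, F e =
      F (Sum.inl ((finRotate n).symm w.1, w.2)) + F (Sum.inr (w.1, (finRotate n).symm w.2)) := by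
  classical
  have h : sndEdges w = {Sum.inl ((finRotate n).symm w.1, w.2), Sum.inr (w.1, (finRotate n).symm w.2)} := by
    ext e
    rw [sndEdges, Finset.mem_filter, Finset.mem_insert, Finset.mem_singleton]
    obtain ⟨a', b'⟩ := w
    rcases e with ⟨a, b⟩ | ⟨a, b⟩
    · simp only [torusEnds_inl, Finset.mem_univ, true_and, Prod.mk.injEq, Sum.inl.injEq,
        reduceCtorEq, or_false]
      rw [Equiv.apply_eq_iff_eq_symm_apply]
    · simp only [torusEnds_inr, Finset.mem_univ, true_and, Prod.mk.injEq, Sum.inr.injEq,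
        reduceCtorEq, false_or]
      rw [Equiv.apply_eq_iff_eq_symm_apply]
  rw [h, Finset.sum_pair (by simp)]

/-- The support of a torus row has at most four variables. [cite: Hastad2020, §2 ("each Tseitin
formula can be written as a 4-CNF formula by having 8 clauses of length four for each node")] -/
theorem supp_torusSystem_card_le (n : ℕ) (i) : (torusSystem n i).supp.card ≤ 4 := by
  classical
  obtain ⟨w, rfl⟩ : ∃ w, i = Fintype.equivFin _ w := ⟨(Fintype.equivFin _).symm i, by simp⟩
  have hsub : (torusSystem n (Fintype.equivFin _ w)).supp ⊆
      (fstEdges w ∪ sndEdges w).map (Fintype.equivFin (TorusEdge n)).toEmbedding := by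
    intro j hj
    have hcoef := (Finset.mem_filter.1 hj).2
    obtain ⟨e, rfl⟩ : ∃ e, j = Fintype.equivFin _ e := ⟨(Fintype.equivFin _).symm j, by simp⟩
    rw [torusSystem_coeff] at hcoef
    rw [Finset.mem_map]
    refine ⟨e, ?_, rfl⟩
    rw [Finset.mem_union, fstEdges, sndEdges, Finset.mem_filter, Finset.mem_filter]
    by_cases h1 : (torusEnds e).1 = w
    · exact Or.inl ⟨Finset.mem_univ _, h1⟩
    · by_cases h2 : (torusEnds e).2 = w
      · exact Or.inr ⟨Finset.mem_univ _, h2⟩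
      · exfalso; apply hcoef; rw [if_neg h1, if_neg h2, add_zero]
  have h1 : (fstEdges w).card ≤ 2 := by
    have := sum_fstEdges (fun _ => (1 : ℕ)) w
    rw [Finset.sum_const, smul_eq_mul, mul_one] at this
    omega
  have h2 : (sndEdges w).card ≤ 2 := by
    have := sum_sndEdges (fun _ => (1 : ℕ)) w
    rw [Finset.sum_const, smul_eq_mul, mul_one] at this
    omega
  calc _ ≤ ((fstEdges w ∪ sndEdges w).map (Fintype.equivFin (TorusEdge n)).toEmbedding).card :=
        Finset.card_le_card hsub
    _ ≤ (fstEdges w).card + (sndEdges w).card := by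
        rw [Finset.card_map]; exact Finset.card_union_le _ _
    _ ≤ 4 := by omega

/-- The clause formulas of the torus contradiction have total size `≤ 224 n²`. [folklore] -/
theorem msum_torusEncoding_le (n : ℕ) :
    msum ((sumEncoding 1 (torusSystem n)).map KrajicekRamsey.clauseOf) ≤ 224 * n ^ 2 := by
  have hlen : (sumEncoding 1 (torusSystem n)).length ≤ n ^ 2 * 16 := by
    unfold sumEncoding
    refine (length_flatMap_le (b := 16) fun i _ => ?_).trans ?_
    · calc (equationCNF 1 (torusSystem n i)).length ≤ 2 ^ ((torusSystem n i).supp.card * 1) :=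
            length_equationCNF_le 1 _
        _ ≤ 2 ^ 4 := Nat.pow_le_pow_right (by norm_num)
            (by rw [Nat.mul_one]; exact supp_torusSystem_card_le n i)
        _ = 16 := by norm_num
    · rw [List.length_finRange, Fintype.card_prod, Fintype.card_fin, pow_two]
  have hW : ∀ X ∈ (sumEncoding 1 (torusSystem n)).map KrajicekRamsey.clauseOf, X.size + 1 ≤ 14 := by
    intro X hX
    obtain ⟨C, hC, rfl⟩ := List.mem_map.1 hX
    simp only [sumEncoding, List.mem_flatMap, List.mem_finRange, true_and] at hC
    obtain ⟨i, hC⟩ := hC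
    have hClen : C.length ≤ 4 := by
      rw [length_of_mem_canonicalCNF hC, length_eqVars, Nat.mul_one]
      exact supp_torusSystem_card_le n i
    have hs : (KrajicekRamsey.clauseOf C).size = msum (C.map KrajicekRamsey.litOf) + 1 := by
      rw [KrajicekRamsey.clauseOf, size_disjList_eq_msum]
    have hm : msum (C.map KrajicekRamsey.litOf) ≤ (C.map KrajicekRamsey.litOf).length * 3 :=
      msum_le_length_mul fun X hX => by
        obtain ⟨l, -, rfl⟩ := List.mem_map.1 hX
        unfold KrajicekRamsey.litOf; split_ifs <;> simp [PropForm.size]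
    rw [List.length_map] at hm
    omega
  calc msum _ ≤ ((sumEncoding 1 (torusSystem n)).map KrajicekRamsey.clauseOf).length * 14 :=
        msum_le_length_mul hW
    _ ≤ (n ^ 2 * 16) * 14 := by rw [List.length_map]; exact Nat.mul_le_mul_right _ hlen
    _ = 224 * n ^ 2 := by ring

/-- **Semantics of a torus parity block**: the row of `w` holds for the block values of `τ` iff
the `𝔽₂`-values of the four torus variables at `w` sum to `1`. [folklore] -/
theorem torusSystem_holds_iff {n : ℕ} (w : Fin n × Fin n) (τ : ℕ → Bool) :
    (torusSystem n (Fintype.equivFin _ w)).Holds (blockVals 2 1 _ τ) ↔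
      (if τ (ti n (Sum.inl w)) then (1 : ZMod 2) else 0) + (if τ (ti n (Sum.inr w)) then 1 else 0) +
        ((if τ (ti n (Sum.inl ((finRotate n).symm w.1, w.2))) then 1 else 0) +
          (if τ (ti n (Sum.inr (w.1, (finRotate n).symm w.2))) then 1 else 0)) = 1 := by
  unfold LinEqMod.Holds
  rw [torusSystem_rowSum, torusSystem_snd, sum_fstEdges, sum_sndEdges]
  simp only [blockVals_one]
  rfl


/-! ### Håstad's embedding of the torus into the grid: the edge labelling -/

namespace TorusEmbedding

/-- Predecessor mod `n` on `ℕ`-representatives: `a - 1`, and `n - 1` for `a = 0`. [folklore] -/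
def predN (n a : ℕ) : ℕ := if a = 0 then n - 1 else a - 1

/-- `predN` is the inverse rotation. [folklore] -/
theorem finRotate_symm_eq_predN {n : ℕ} (a : Fin n) :
    ((finRotate n).symm a : ℕ) = predN n a := by
  obtain ⟨m, rfl⟩ : ∃ m, n = m + 1 := ⟨n - 1, by have := a.pos; omega⟩
  by_cases h0 : (a : ℕ) = 0
  · rw [predN, if_pos h0]
    have h := @finRotate_last' m
    have h1 : (finRotate (m + 1)).symm ⟨0, Nat.zero_lt_succ _⟩ = ⟨m, by omega⟩ := by
      rw [Equiv.symm_apply_eq]; exact h.symm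
    have ha : a = ⟨0, Nat.zero_lt_succ _⟩ := Fin.ext h0
    rw [ha, h1]
    simp
  · rw [predN, if_neg h0]
    have hlt : (a : ℕ) - 1 < m := by omega
    have h := finRotate_of_lt hlt
    have h1 : (finRotate (m + 1)).symm a = ⟨(a : ℕ) - 1, by omega⟩ := by
      rw [Equiv.symm_apply_eq, h]; ext; simp only; omega
    rw [h1]

/-- The torus row of the short path through row `i` of an odd column: `(i-1)/2`, and `n - 1` for
the wrap-around edge entering through row `0`. [folklore] -/
def A (n i : ℕ) : ℕ := if i = 0 then n - 1 else (i - 1) / 2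

/-- **The edge labelling (vertical grid edges).** The torus edge — coded `(dir, a, b)` for
`Sum.inl (a, b)` (`dir = false`) / `Sum.inr (a, b)` (`dir = true`) — whose path uses the vertical
grid edge `(i, c) — (i+1, c)` of `𝓗_{k,k}` (`k ≥ 2n+1`), if any. Torus vertex `(a, b)` sits at the
cell `(2a+1, 2b+1)`; the edge `inl (a, b) = (a,b) — (a+1,b)` is the path `(2a+1,2b+1) — (2a+2,2b+1)
— (2a+3,2b+1)` for `a ≤ n-2` and, for `a = n-1`, the wrap-around path down column `2b+1` to the frame
row `2n+1`, along it to column `2b+2`, up the whole column `2b+2` to the frame row `0` and back to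
column `2b+1`; symmetrically for `inr`. So: odd columns `2b+1 ≤ 2n-1` carry `inl (A i, b)`, even
columns `2 ≤ 2b+2 ≤ 2n` carry the wrap-around edge `inl (n-1, b)`, and the frame columns `0`,
`2n+1` carry, between rows `2a+1` and `2a+2`, the wrap-around edge `inr (a, n-1)`.
[cite: Hastad2020, §8 "Final words" ("it is possible to embed the n × n torus in a
(2n+3) × (2n+2) grid. The wrap around edges are mapped to paths of full length running between the
vertices of the torus that are mapped in the natural way to nodes with both coordinates even")] -/
def teV (n i c : ℕ) : Option (Bool × ℕ × ℕ) :=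
  if i ≤ 2 * n then
    if c % 2 = 1 ∧ c ≤ 2 * n - 1 then some (false, A n i, (c - 1) / 2)
    else if c % 2 = 0 ∧ 2 ≤ c ∧ c ≤ 2 * n then some (false, n - 1, (c - 2) / 2)
    else if (c = 0 ∨ c = 2 * n + 1) ∧ i % 2 = 1 ∧ i ≤ 2 * n - 1 then some (true, (i - 1) / 2, n - 1)
    else none
  else none

/-- Swapping the two coordinates and the two directions of a coded torus edge. [folklore] -/
def swapCode (t : Bool × ℕ × ℕ) : Bool × ℕ × ℕ := (!t.1, t.2.2, t.2.1)

/-- **The edge labelling (horizontal grid edges)**, by the symmetry of the construction in the two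
coordinates: the horizontal edge `(i, c) — (i, c+1)` carries the swap of what the vertical edge
`(c, i) — (c+1, i)` carries. [cite: Hastad2020, §8 "Final words"] -/
def teH (n i c : ℕ) : Option (Bool × ℕ × ℕ) := (teV n c i).map swapCode

section Values

variable (τ : Bool → ℕ → ℕ → ZMod 2)

/-- The value of the path term of an edge label under torus values `τ`. [folklore] -/
def pvN : Option (Bool × ℕ × ℕ) → ZMod 2
  | none => 0
  | some t => τ t.1 t.2.1 t.2.2

/-- Torus values with coordinates and directions swapped. [folklore] -/
def swapVal : Bool → ℕ → ℕ → ZMod 2 := fun s a b => τ (!s) b a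

/-- Path value of a swapped label. [folklore] -/
theorem pvN_map_swapCode (o : Option (Bool × ℕ × ℕ)) :
    pvN τ (o.map swapCode) = pvN (swapVal τ) o := by
  cases o <;> rfl

/-! #### Evaluation of the labelling -/

variable {n : ℕ}

/-- `A` on row `0`. [folklore] -/
theorem A_zero (n : ℕ) : A n 0 = n - 1 := rfl

/-- `A` on an odd row. [folklore] -/
theorem A_odd (n a : ℕ) : A n (2 * a + 1) = a := by
  rw [A, if_neg (by omega)]; omega

/-- `A` on a positive even row. [folklore] -/
theorem A_even (n a : ℕ) : A n (2 * a + 2) = a := by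
  rw [A, if_neg (by omega)]; omega

/-- Odd columns `2b+1 ≤ 2n-1`, rows `≤ 2n`: the short paths (and the ends of the wrap-around path)
of the edges `inl (·, b)`. [folklore] -/
theorem teV_oddCol {i b : ℕ} (hi : i ≤ 2 * n) (hb : b < n) :
    teV n i (2 * b + 1) = some (false, A n i, b) := by
  rw [teV, if_pos hi, if_pos ⟨by omega, by omega⟩, show (2 * b + 1 - 1) / 2 = b by omega]

/-- Even columns `2 ≤ 2b+2 ≤ 2n`, rows `≤ 2n`: the wrap-around path of `inl (n-1, b)`. [folklore] -/
theorem teV_evenCol {i b : ℕ} (hi : i ≤ 2 * n) (hb : b < n) :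
    teV n i (2 * b + 2) = some (false, n - 1, b) := by
  rw [teV, if_pos hi, if_neg (by omega), if_pos ⟨by omega, by omega, by omega⟩,
    show (2 * b + 2 - 2) / 2 = b by omega]

/-- Frame columns `0` and `2n+1`, between rows `2a+1` and `2a+2`: the wrap-around path of
`inr (a, n-1)`. [folklore] -/
theorem teV_frame_odd {c a : ℕ} (hc : c = 0 ∨ c = 2 * n + 1) (ha : a < n) :
    teV n (2 * a + 1) c = some (true, a, n - 1) := by
  rw [teV, if_pos (by omega), if_neg (by omega), if_neg (by omega), if_pos ⟨hc, by omega, by omega⟩,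
    show (2 * a + 1 - 1) / 2 = a by omega]

/-- Frame columns: no other vertical edge is used. [folklore] -/
theorem teV_frame_even {c i : ℕ} (hc : c = 0 ∨ c = 2 * n + 1) (hi : i % 2 = 0) : teV n i c = none := by
  rw [teV]
  split_ifs with h1 h2 h3 h4
  · exfalso; omega
  · exfalso; omega
  · exfalso; omega
  · rfl
  · rfl

/-- No vertical edge below row `2n` is used. [folklore] -/
theorem teV_bigRow {i c : ℕ} (hi : 2 * n < i) : teV n i c = none := by
  rw [teV, if_neg (by omega)]

/-- No vertical edge beyond column `2n+1` is used. [folklore] -/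
theorem teV_bigCol {i c : ℕ} (hc : 2 * n + 2 ≤ c) : teV n i c = none := by
  rw [teV]
  split_ifs with h1 h2 h3 h4
  · exfalso; omega
  · exfalso; omega
  · exfalso; omega
  · rfl
  · rfl

/-! #### The two vertical edges at a cell -/

/-- The path terms of the (at most two) vertical edges at the cell `(i, c)`. [folklore] -/
def VP (n i c : ℕ) : ZMod 2 :=
  pvN τ (teV n i c) + if i = 0 then 0 else pvN τ (teV n (i - 1) c)

/-- The branch term: at a torus cell `(2a+1, 2b+1)`, the two edges `inl (a, b)` and
`inl (a-1, b)`. [folklore] -/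
def Bt (n i c : ℕ) : ZMod 2 :=
  if i % 2 = 1 ∧ i ≤ 2 * n - 1 ∧ c % 2 = 1 ∧ c ≤ 2 * n - 1 then
    τ false ((i - 1) / 2) ((c - 1) / 2) + τ false (predN n ((i - 1) / 2)) ((c - 1) / 2)
  else 0

/-- The first frame term: in the frame rows `0`, `2n+1`, the wrap-around edge of the column.
[folklore] -/
def Gt (n i c : ℕ) : ZMod 2 :=
  if 1 ≤ c ∧ c ≤ 2 * n ∧ (i = 0 ∨ i = 2 * n + 1) then τ false (n - 1) ((c - 1) / 2) else 0

/-- The second frame term: in the frame columns `0`, `2n+1`, the wrap-around edge turning there.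
[folklore] -/
def Gt' (n i c : ℕ) : ZMod 2 :=
  if (c = 0 ∨ c = 2 * n + 1) ∧ 1 ≤ i ∧ i ≤ 2 * n then τ true ((i - 1) / 2) (n - 1) else 0

/-- Case distinction on a column index. [folklore] -/
theorem col_cases (n c : ℕ) :
    (∃ b, b < n ∧ c = 2 * b + 1) ∨ (∃ b, b < n ∧ c = 2 * b + 2) ∨ (c = 0 ∨ c = 2 * n + 1) ∨ 2 * n + 2 ≤ c := by
  rcases Nat.even_or_odd' c with ⟨m, rfl | rfl⟩
  · rcases Nat.eq_zero_or_pos m with rfl | hm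
    · exact Or.inr (Or.inr (Or.inl (Or.inl rfl)))
    · by_cases hmn : m ≤ n
      · exact Or.inr (Or.inl ⟨m - 1, by omega, by omega⟩)
      · exact Or.inr (Or.inr (Or.inr (by omega)))
  · by_cases hmn : m < n
    · exact Or.inl ⟨m, hmn, rfl⟩
    · by_cases hmn' : m = n
      · exact Or.inr (Or.inr (Or.inl (Or.inr (by omega))))
      · exact Or.inr (Or.inr (Or.inr (by omega)))

/-- **The vertical path terms at a cell, in closed form.** [folklore] -/
theorem VP_eq (hn : 1 ≤ n) (i c : ℕ) : VP τ n i c = Bt τ n i c + Gt τ n i c + Gt' τ n i c := by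
  rcases col_cases n c with ⟨b, hb, rfl⟩ | ⟨b, hb, rfl⟩ | hc | hc
  · -- odd column `2b+1 ≤ 2n-1`
    have hG' : Gt' τ n i (2 * b + 1) = 0 := by rw [Gt', if_neg (by omega)]
    rw [hG', add_zero]
    rcases col_cases n i with ⟨a, ha, rfl⟩ | ⟨a, ha, rfl⟩ | (rfl | rfl) | hi
    · -- torus cell
      rw [VP, if_neg (by omega), teV_oddCol (by omega) hb, teV_oddCol (by omega) hb, Bt,
        if_pos ⟨by omega, by omega, by omega, by omega⟩, Gt, if_neg (by omega), add_zero, A_odd,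
        show 2 * a + 1 - 1 = 2 * a by omega, show (2 * a) / 2 = a by omega,
        show (2 * b + 1 - 1) / 2 = b by omega]
      simp only [pvN]
      congr 2
      rw [A, predN]
      by_cases ha0 : a = 0
      · rw [if_pos (by omega), if_pos ha0]
      · rw [if_neg (by omega), if_neg ha0]; omega
    · -- crossing in a positive even row
      rw [VP, if_neg (by omega), teV_oddCol (by omega) hb, teV_oddCol (by omega) hb, Bt,
        if_neg (by omega), Gt, if_neg (by omega), add_zero, A_even,
        show 2 * a + 2 - 1 = 2 * a + 1 by omega, A_odd]
      simp only [pvN]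
      exact CharTwo.add_self_eq_zero _
    · -- frame row 0
      rw [VP, if_pos rfl, teV_oddCol (by omega) hb, Bt, if_neg (by omega), Gt,
        if_pos ⟨by omega, by omega, Or.inl rfl⟩, A_zero, show (2 * b + 1 - 1) / 2 = b by omega]
      simp [pvN]
    · -- frame row 2n+1
      rw [VP, if_neg (by omega), teV_bigRow (by omega), teV_oddCol (by omega) hb, Bt,
        if_neg (by omega), Gt, if_pos ⟨by omega, by omega, Or.inr rfl⟩,
        show (2 * b + 1 - 1) / 2 = b by omega, show 2 * n + 1 - 1 = 2 * (n - 1) + 2 by omega, A_even]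
      simp [pvN]
    · -- below the frame
      rw [VP, if_neg (by omega), teV_bigRow (by omega), teV_bigRow (by omega), Bt, if_neg (by omega),
        Gt, if_neg (by omega)]
      simp [pvN]
  · -- even column `2 ≤ 2b+2 ≤ 2n`
    have hG' : Gt' τ n i (2 * b + 2) = 0 := by rw [Gt', if_neg (by omega)]
    have hB : Bt τ n i (2 * b + 2) = 0 := by rw [Bt, if_neg (by omega)]
    rw [hG', hB, add_zero, zero_add, Gt, show (2 * b + 2 - 1) / 2 = b by omega]
    rcases Nat.eq_zero_or_pos i with rfl | hi0
    · rw [VP, if_pos rfl, teV_evenCol (by omega) hb, if_pos ⟨by omega, by omega, Or.inl rfl⟩]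
      simp [pvN]
    · by_cases hi : i ≤ 2 * n
      · rw [VP, if_neg (by omega), teV_evenCol hi hb, teV_evenCol (by omega) hb, if_neg (by omega)]
        simp only [pvN]
        exact CharTwo.add_self_eq_zero _
      · by_cases hi' : i = 2 * n + 1
        · rw [VP, if_neg (by omega), teV_bigRow (by omega), teV_evenCol (by omega) hb,
            if_pos ⟨by omega, by omega, Or.inr hi'⟩]
          simp [pvN]
        · rw [VP, if_neg (by omega), teV_bigRow (by omega), teV_bigRow (by omega), if_neg (by omega)]
          simp [pvN]
  · -- frame columns `0`, `2n+1`
    have hG : Gt τ n i c = 0 := by rw [Gt, if_neg (by omega)]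
    have hB : Bt τ n i c = 0 := by
      rw [Bt, if_neg]
      rintro ⟨-, -, h1, h2⟩
      omega
    rw [hG, hB, add_zero, zero_add, Gt']
    rcases col_cases n i with ⟨a, ha, rfl⟩ | ⟨a, ha, rfl⟩ | (rfl | rfl) | hi
    · rw [VP, if_neg (by omega), teV_frame_odd hc ha, show 2 * a + 1 - 1 = 2 * a by omega,
        teV_frame_even hc (by omega), if_pos ⟨hc, by omega, by omega⟩, show 2 * a / 2 = a by omega]
      simp [pvN]
    · rw [VP, if_neg (by omega), teV_frame_even hc (by omega), show 2 * a + 2 - 1 = 2 * a + 1 by omega,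
        teV_frame_odd hc ha, if_pos ⟨hc, by omega, by omega⟩, show (2 * a + 1) / 2 = a by omega]
      simp [pvN]
    · rw [VP, if_pos rfl, teV_frame_even hc (by omega), if_neg (by omega)]
      simp [pvN]
    · rw [VP, if_neg (by omega), teV_bigRow (by omega), show 2 * n + 1 - 1 = 2 * n by omega,
        teV_frame_even hc (by omega), if_neg (by omega)]
      simp [pvN]
    · rw [VP, if_neg (by omega), teV_bigRow (by omega), teV_bigRow (by omega), if_neg (by omega)]
      simp [pvN]
  · -- beyond the frame
    have hB : Bt τ n i c = 0 := by rw [Bt, if_neg (by omega)]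
    have hG : Gt τ n i c = 0 := by rw [Gt, if_neg (by omega)]
    have hG' : Gt' τ n i c = 0 := by rw [Gt', if_neg (by omega)]
    rw [hB, hG, hG', VP, teV_bigCol hc]
    by_cases hi : i = 0
    · rw [if_pos hi]; simp [pvN]
    · rw [if_neg hi, teV_bigCol hc]; simp [pvN]

/-! #### The four edges at a cell -/

/-- The path terms of the four grid edges at the cell `(i, c)`: the two vertical ones plus the two
horizontal ones (which are the vertical ones of the transposed picture). [folklore] -/
def cellSum (n i c : ℕ) : ZMod 2 := VP τ n i c + VP (swapVal τ) n c i

/-- The first frame term transposes into the second. [folklore] -/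
theorem Gt_swap (n i c : ℕ) : Gt (swapVal τ) n c i = Gt' τ n i c := by
  unfold Gt Gt' swapVal
  by_cases h : (c = 0 ∨ c = 2 * n + 1) ∧ 1 ≤ i ∧ i ≤ 2 * n
  · rw [if_pos h, if_pos ⟨h.2.1, h.2.2, h.1⟩]; rfl
  · rw [if_neg h, if_neg (fun h' => h ⟨h'.2.2, h'.1, h'.2.1⟩)]

/-- The second frame term transposes into the first. [folklore] -/
theorem Gt'_swap (n i c : ℕ) : Gt' (swapVal τ) n c i = Gt τ n i c := by
  unfold Gt Gt' swapVal
  by_cases h : 1 ≤ c ∧ c ≤ 2 * n ∧ (i = 0 ∨ i = 2 * n + 1)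
  · rw [if_pos h, if_pos ⟨h.2.2, h.1, h.2.1⟩]; rfl
  · rw [if_neg h, if_neg (fun h' => h ⟨h'.2.1, h'.2.2, h'.1⟩)]

/-- **The incidence identity of the embedding.** The path terms of the four grid edges at a cell
sum to the left-hand side of the torus row of `(a, b)` at the torus cell `(2a+1, 2b+1)` — the four
paths of the torus edges at `(a, b)` end there — and to `0` at every other cell, through which every
path passes an even number of times (straight, turning, or two paths crossing). [cite: Hastad2020,
§8 "Final words" (the embedding of the torus in the grid)] -/
theorem cellSum_eq (hn : 1 ≤ n) (i c : ℕ) :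
    cellSum τ n i c =
      if i % 2 = 1 ∧ i ≤ 2 * n - 1 ∧ c % 2 = 1 ∧ c ≤ 2 * n - 1 then
        τ false ((i - 1) / 2) ((c - 1) / 2) + τ false (predN n ((i - 1) / 2)) ((c - 1) / 2) +
          (τ true ((i - 1) / 2) ((c - 1) / 2) + τ true ((i - 1) / 2) (predN n ((c - 1) / 2)))
      else 0 := by
  rw [cellSum, VP_eq τ hn, VP_eq (swapVal τ) hn, Gt_swap, Gt'_swap]
  have hB : Bt (swapVal τ) n c i =
      if i % 2 = 1 ∧ i ≤ 2 * n - 1 ∧ c % 2 = 1 ∧ c ≤ 2 * n - 1 then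
        τ true ((i - 1) / 2) ((c - 1) / 2) + τ true ((i - 1) / 2) (predN n ((c - 1) / 2)) else 0 := by
    unfold Bt swapVal
    by_cases h : i % 2 = 1 ∧ i ≤ 2 * n - 1 ∧ c % 2 = 1 ∧ c ≤ 2 * n - 1
    · rw [if_pos h, if_pos ⟨h.2.2.1, h.2.2.2, h.1, h.2.1⟩]; rfl
    · rw [if_neg h, if_neg (fun h' => h ⟨h'.2.2.1, h'.2.2.2, h'.1, h'.2.1⟩)]
  rw [hB, Bt]
  split_ifs with h
  · generalize Gt τ n i c = x
    generalize Gt' τ n i c = y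
    have hx := CharTwo.add_self_eq_zero x
    have hy := CharTwo.add_self_eq_zero y
    -- rearrange: B + x + y + (B' + y + x) = B + B'
    calc _ = (τ false ((i - 1) / 2) ((c - 1) / 2) + τ false (predN n ((i - 1) / 2)) ((c - 1) / 2) +
          (τ true ((i - 1) / 2) ((c - 1) / 2) + τ true ((i - 1) / 2) (predN n ((c - 1) / 2)))) +
          (x + x) + (y + y) := by ring
      _ = _ := by rw [hx, hy, add_zero, add_zero]
  · generalize Gt τ n i c = x
    generalize Gt' τ n i c = y
    have hx := CharTwo.add_self_eq_zero x
    have hy := CharTwo.add_self_eq_zero y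
    calc _ = (x + x) + (y + y) := by ring
      _ = 0 := by rw [hx, hy, add_zero]

end Values

/-- `A` on an even row is the predecessor of half the row. [folklore] -/
theorem A_two_mul (n a : ℕ) : A n (2 * a) = predN n a := by
  unfold A predN
  by_cases ha : a = 0
  · rw [if_pos (by omega), if_pos ha]
  · rw [if_neg (by omega), if_neg ha]; omega

/-! ### The labelling on the grid `𝓗_{k,k}` and the substitution -/

open GridLabel

variable {k : ℕ}

/-- The label of a grid edge of `𝓗_{k,k}`. [cite: Hastad2020, §8 "Final words"] -/
def te (n : ℕ) : GridEdge k → Option (Bool × ℕ × ℕ)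
  | Sum.inl (i, c) => teH n i c
  | Sum.inr (i, c) => teV n i c

/-- Decoding a code `(dir, a, b)` into the torus edge `inl (a, b)` / `inr (a, b)` (none if out of
range). [folklore] -/
def ofCode (n : ℕ) (t : Bool × ℕ × ℕ) : Option (TorusEdge n) :=
  if h : t.2.1 < n ∧ t.2.2 < n then
    some (if t.1 then Sum.inr (⟨t.2.1, h.1⟩, ⟨t.2.2, h.2⟩) else Sum.inl (⟨t.2.1, h.1⟩, ⟨t.2.2, h.2⟩))
  else none

/-- The torus edge whose path uses the grid edge `ε` (none off the paths). [cite: Hastad2020, §8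
"Final words"] -/
def tedge (n : ℕ) (ε : GridEdge k) : Option (TorusEdge n) := (te n ε).bind (ofCode n)

/-- Torus values read off a Boolean assignment `ρ` of the torus variables, on codes. [folklore] -/
noncomputable def τN (n : ℕ) (ρ : ℕ → Bool) : Bool → ℕ → ℕ → ZMod 2 := fun s a b =>
  match ofCode n (s, a, b) with
  | none => 0
  | some e => zv (ρ (ti n e))

/-- The value under `ρ` of the path term of a grid edge. [folklore] -/
noncomputable def pathVal (n : ℕ) (ρ : ℕ → Bool) (ε : GridEdge k) : ZMod 2 :=
  match tedge n ε with
  | none => 0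
  | some e => zv (ρ (ti n e))

/-- The path value of an edge is the path term of its label. [folklore] -/
theorem pathVal_eq (n : ℕ) (ρ : ℕ → Bool) (ε : GridEdge k) :
    pathVal n ρ ε = pvN (τN n ρ) (te n ε) := by
  unfold pathVal tedge
  cases te n ε with
  | none => rfl
  | some t => rfl

/-- **The substituted formula of a grid edge**: the literal `x_e ⊕ β(ε)` if the path of the torus
edge `e` uses `ε`, the constant `β(ε)` otherwise, where `β = GridLabel.cbit k dm` routes the demand
`dm` (a `T`-join). [cite: GalesiEtAl2023, Lemmas 12–15 (restriction and suppression are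
substitutions of constants and signed literals)] -/
noncomputable def edgeForm (n : ℕ) (dm : Fin (k + 1) × Fin (k + 1) → ZMod 2) (ε : GridEdge k) :
    PropForm ℕ :=
  match tedge n ε with
  | none => .const (decide (cbit k dm ε = 1))
  | some e => signForm (cbit k dm ε) (.var (ti n e))

/-- Value of the substituted formula of an edge: constant bit plus path value. [folklore] -/
theorem zv_eval_edgeForm (n : ℕ) (dm : Fin (k + 1) × Fin (k + 1) → ZMod 2) (ρ : ℕ → Bool)
    (ε : GridEdge k) : zv ((edgeForm n dm ε).eval ρ) = cbit k dm ε + pathVal n ρ ε := by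
  unfold edgeForm pathVal
  cases tedge n ε with
  | none => simp [PropForm.eval, zv_decide_eq_one]
  | some e =>
    have h := eval_signForm_val (cbit k dm ε) (.var (ti n e)) ρ
    simp only [PropForm.eval] at h
    exact h

/-- The substituted formulas have size `≤ 2`. [folklore] -/
theorem size_edgeForm_le (n : ℕ) (dm : Fin (k + 1) × Fin (k + 1) → ZMod 2) (ε : GridEdge k) :
    (edgeForm n dm ε).size ≤ 2 := by
  unfold edgeForm
  cases tedge n ε with
  | none => simp [PropForm.size]
  | some e => exact (size_signForm_le _ _).trans (by simp [PropForm.size])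

/-- The substituted formulas have auxiliary depths `≤ 1`. [folklore] -/
theorem altDepthAux_edgeForm_le (n : ℕ) (dm : Fin (k + 1) × Fin (k + 1) → ZMod 2) (ε : GridEdge k)
    (c : ℕ) : altDepthAux c (edgeForm n dm ε) ≤ 1 := by
  unfold edgeForm
  cases tedge n ε with
  | none => simp [PropForm.altDepthAux]
  | some e => exact altDepthAux_signForm_le _ _ (fun c => by simp [PropForm.altDepthAux]) c

/-- The variables of the substituted formula of an edge: the variable of its torus edge.
[folklore] -/
theorem mem_vars_edgeForm {n : ℕ} {dm : Fin (k + 1) × Fin (k + 1) → ZMod 2} {ε : GridEdge k} {x : ℕ}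
    (hx : x ∈ (edgeForm n dm ε).vars) : ∃ e, tedge n ε = some e ∧ x = ti n e := by
  unfold edgeForm at hx
  cases h : tedge n ε with
  | none => rw [h] at hx; simp [PropForm.vars] at hx
  | some e =>
    rw [h] at hx
    simp only [vars_signForm, PropForm.vars, Finset.mem_singleton] at hx
    exact ⟨e, rfl, hx⟩

/-- The substituted formula of an edge has at most one variable. [folklore] -/
theorem card_vars_edgeForm_le (n : ℕ) (dm : Fin (k + 1) × Fin (k + 1) → ZMod 2) (ε : GridEdge k) :
    (edgeForm n dm ε).vars.card ≤ 1 := by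
  unfold edgeForm
  cases tedge n ε with
  | none => simp [PropForm.vars]
  | some e => simp [vars_signForm, PropForm.vars]

/-- **The substitution** `σ` on variable indices of `gridSystem k f`. [cite: GalesiEtAl2023,
§3.1–3.2 (the composed substitution)] -/
noncomputable def subst (n : ℕ) (dm : Fin (k + 1) × Fin (k + 1) → ZMod 2) : ℕ → PropForm ℕ := fun j =>
  if h : j < Fintype.card (GridEdge k) then edgeForm n dm (dec k j h) else .var j

/-- The substitution on the variable of an edge. [folklore] -/
theorem subst_gi (n : ℕ) (dm : Fin (k + 1) × Fin (k + 1) → ZMod 2) (ε : GridEdge k) :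
    subst n dm (gi k ε) = edgeForm n dm ε := by
  rw [subst, dif_pos (gi_lt ε), dec_gi]

/-- The substituted formulas have size `≤ 2`. [folklore] -/
theorem size_subst_le (n : ℕ) (dm : Fin (k + 1) × Fin (k + 1) → ZMod 2) (x : ℕ) :
    (subst n dm x).size ≤ 2 := by
  unfold subst
  split_ifs
  · exact size_edgeForm_le _ _ _
  · simp [PropForm.size]

/-- The substituted formulas have auxiliary depths `≤ 1`. [folklore] -/
theorem altDepthAux_subst_le (n : ℕ) (dm : Fin (k + 1) × Fin (k + 1) → ZMod 2) (x c : ℕ) :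
    altDepthAux c (subst n dm x) ≤ 1 := by
  unfold subst
  split_ifs
  · exact altDepthAux_edgeForm_le _ _ _ _
  · simp [PropForm.altDepthAux]

/-! ### The row sums under the substitution -/

/-- Through the extension by zero, the vertical path terms are those of `teV` (for `k ≥ 2n+1`
nothing is cut off). [folklore] -/
theorem extV_pathTerm {n : ℕ} (hk : 2 * n + 1 ≤ k) (τ : Bool → ℕ → ℕ → ZMod 2) (i c : ℕ) :
    extV (fun ε : GridEdge k => pvN τ (te n ε)) i c = pvN τ (teV n i c) := by
  unfold extV
  split_ifs with h
  · rfl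
  · rw [not_and_or, not_lt, not_lt] at h
    rcases h with h | h
    · rw [teV_bigRow (by omega)]; rfl
    · rw [teV_bigCol (by omega)]; rfl

/-- Through the extension by zero, the horizontal path terms are the transposed vertical ones.
[folklore] -/
theorem extH_pathTerm {n : ℕ} (hk : 2 * n + 1 ≤ k) (τ : Bool → ℕ → ℕ → ZMod 2) (i c : ℕ) :
    extH (fun ε : GridEdge k => pvN τ (te n ε)) i c = pvN (swapVal τ) (teV n c i) := by
  unfold extH
  split_ifs with h
  · show pvN τ (teH n i c) = _
    rw [teH, pvN_map_swapCode]
  · rw [not_and_or, not_lt, not_lt] at h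
    rcases h with h | h
    · rw [teV_bigCol (by omega)]; rfl
    · rw [teV_bigRow (by omega)]; rfl

/-- The path terms of the four edges at a cell sum to `cellSum`. [folklore] -/
theorem sum_pathTerm {n : ℕ} (hk : 2 * n + 1 ≤ k) (τ : Bool → ℕ → ℕ → ZMod 2)
    (w : Fin (k + 1) × Fin (k + 1)) :
    ∑ ε ∈ leftEdges w, pvN τ (te n ε) + ∑ ε ∈ rightEdges w, pvN τ (te n ε) =
      cellSum τ n w.1 w.2 := by
  rw [sum_leftEdges, sum_rightEdges]
  simp only [extV_pathTerm hk, extH_pathTerm hk]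
  unfold cellSum VP
  have e1 : (if ((w.2 : ℕ) = 0) then (0 : ZMod 2) else pvN (swapVal τ) (teV n ((w.2 : ℕ) - 1) w.1)) =
      if ((w.2 : ℕ) = 0) then 0 else pvN (swapVal τ) (teV n ((w.2 : ℕ) - 1) w.1) := rfl
  ring

/-- **The row sums under the substitution.** At every cell, the values of the substituted formulas
of the incident edges sum to the demand plus the incidence term `cellSum` (for a demand of total
`0`, `k ≥ 2n+1`, `k ≥ 1`). [folklore] -/
theorem rowSum_edgeForm {n : ℕ} (hk1 : 1 ≤ k) (hk : 2 * n + 1 ≤ k)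
    {dm : Fin (k + 1) × Fin (k + 1) → ZMod 2} (htot : ∑ w, dm w = 0) (ρ : ℕ → Bool)
    (w : Fin (k + 1) × Fin (k + 1)) :
    ∑ ε ∈ leftEdges w, zv ((edgeForm n dm ε).eval ρ) + ∑ ε ∈ rightEdges w, zv ((edgeForm n dm ε).eval ρ) =
      dm w + cellSum (τN n ρ) n w.1 w.2 := by
  simp only [zv_eval_edgeForm, Finset.sum_add_distrib, pathVal_eq]
  rw [add_add_add_comm, sum_cbit hk1 htot, sum_pathTerm hk]

/-! ### The demand: charges plus the torus cells -/

/-- The indicator of the torus cells `(2a+1, 2b+1)`, `a, b < n`, on `ℕ × ℕ`. [folklore] -/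
def brN (n i c : ℕ) : ZMod 2 :=
  if i % 2 = 1 ∧ i ≤ 2 * n - 1 ∧ c % 2 = 1 ∧ c ≤ 2 * n - 1 then 1 else 0

/-- The demand routed by the constant bits: the charge plus the indicator of the torus cells (so
that a torus cell is left with charge `1` for its torus row, every other cell with `0`).
[cite: GalesiEtAl2023, Lemmas 11–15 (the constants and signs of the substitution absorb the
charges off the branch vertices)] -/
def dem (n : ℕ) (f : Fin (k + 1) × Fin (k + 1) → ZMod 2) (w : Fin (k + 1) × Fin (k + 1)) : ZMod 2 :=
  f w + brN n w.1 w.2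

/-- The number of odd indices `≤ 2n-1` below `k+1 ≥ 2n` is `n`. [folklore] -/
theorem card_filter_oddLe {n : ℕ} (hk : 2 * n ≤ k + 1) :
    (univ.filter fun i : Fin (k + 1) => (i : ℕ) % 2 = 1 ∧ (i : ℕ) ≤ 2 * n - 1).card = n := by
  set emb : Fin n ↪ Fin (k + 1) := ⟨fun a => ⟨2 * (a : ℕ) + 1, by have := a.isLt; omega⟩,
    fun a b hab => by
      have h : 2 * (a : ℕ) + 1 = 2 * (b : ℕ) + 1 := congrArg Fin.val hab
      exact Fin.ext (by omega)⟩ with hemb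
  have h : (univ.filter fun i : Fin (k + 1) => (i : ℕ) % 2 = 1 ∧ (i : ℕ) ≤ 2 * n - 1) =
      (univ : Finset (Fin n)).map emb := by
    ext i
    simp only [Finset.mem_filter, Finset.mem_univ, true_and, Finset.mem_map, hemb,
      Function.Embedding.coeFn_mk]
    constructor
    · rintro ⟨h1, h2⟩
      refine ⟨⟨(i : ℕ) / 2, by omega⟩, ?_⟩
      apply Fin.ext
      simp only
      omega
    · rintro ⟨a, rfl⟩
      have := a.isLt
      simp only
      omega
  rw [h, Finset.card_map, Finset.card_univ, Fintype.card_fin]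

/-- The torus cells number `n² ≡ n (mod 2)`. [folklore] -/
theorem sum_brN {n : ℕ} (hk : 2 * n ≤ k + 1) :
    ∑ w : Fin (k + 1) × Fin (k + 1), brN n w.1 w.2 = (n * n : ℕ) := by
  classical
  have h1 : ∀ w : Fin (k + 1) × Fin (k + 1), brN n w.1 w.2 =
      if ((w.1 : ℕ) % 2 = 1 ∧ (w.1 : ℕ) ≤ 2 * n - 1) ∧ ((w.2 : ℕ) % 2 = 1 ∧ (w.2 : ℕ) ≤ 2 * n - 1)
      then 1 else 0 := by
    intro w; unfold brN
    by_cases h : (w.1 : ℕ) % 2 = 1 ∧ (w.1 : ℕ) ≤ 2 * n - 1 ∧ (w.2 : ℕ) % 2 = 1 ∧ (w.2 : ℕ) ≤ 2 * n - 1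
    · rw [if_pos h, if_pos ⟨⟨h.1, h.2.1⟩, h.2.2⟩]
    · rw [if_neg h, if_neg (fun h' => h ⟨h'.1.1, h'.1.2, h'.2.1, h'.2.2⟩)]
  have h2 : ∀ w : Fin (k + 1) × Fin (k + 1), brN n w.1 w.2 =
      (if ((w.1 : ℕ) % 2 = 1 ∧ (w.1 : ℕ) ≤ 2 * n - 1) then (1 : ZMod 2) else 0) *
        (if ((w.2 : ℕ) % 2 = 1 ∧ (w.2 : ℕ) ≤ 2 * n - 1) then 1 else 0) := by
    intro w; rw [h1, ite_zero_mul_ite_zero, one_mul]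
  simp only [h2]
  rw [Fintype.sum_prod_type]
  dsimp only
  have hprod := Finset.sum_mul_sum (univ : Finset (Fin (k + 1))) (univ : Finset (Fin (k + 1)))
    (fun i => if ((i : ℕ) % 2 = 1 ∧ (i : ℕ) ≤ 2 * n - 1) then (1 : ZMod 2) else 0)
    (fun i => if ((i : ℕ) % 2 = 1 ∧ (i : ℕ) ≤ 2 * n - 1) then (1 : ZMod 2) else 0)
  rw [← hprod, Finset.sum_boole, card_filter_oddLe hk, Nat.cast_mul]

/-- **The total demand vanishes** when the total charge is odd and `n` is odd. [folklore] -/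
theorem sum_dem {n : ℕ} (hn : Odd n) (hk : 2 * n ≤ k + 1) {f : Fin (k + 1) × Fin (k + 1) → ZMod 2}
    (hf : ∑ w, f w = 1) : ∑ w, dem n f w = 0 := by
  simp only [dem, Finset.sum_add_distrib, hf, sum_brN hk]
  have h : ((n * n : ℕ) : ZMod 2) = 1 := by
    rw [ZMod.natCast_eq_one_iff_odd]; exact hn.mul hn
  rw [h]; decide

/-! ### The row equations under the substitution -/

/-- The indicator plus the incidence term: `0` off the torus cells, `1 +` the left-hand side of the
torus row at a torus cell. [folklore] -/
theorem brN_add_cellSum {n : ℕ} (hn : 1 ≤ n) (τ : Bool → ℕ → ℕ → ZMod 2) (i c : ℕ) :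
    brN n i c + cellSum τ n i c =
      if i % 2 = 1 ∧ i ≤ 2 * n - 1 ∧ c % 2 = 1 ∧ c ≤ 2 * n - 1 then
        1 + (τ false ((i - 1) / 2) ((c - 1) / 2) + τ false (predN n ((i - 1) / 2)) ((c - 1) / 2) +
          (τ true ((i - 1) / 2) ((c - 1) / 2) + τ true ((i - 1) / 2) (predN n ((c - 1) / 2))))
      else 0 := by
  rw [brN, cellSum_eq τ hn]
  split_ifs <;> simp

/-- **The row of a cell under the substitution** holds for the values induced by `ρ` iff the cell
is not a torus cell, or it is the torus cell `(2a+1, 2b+1)` and the four torus values at `(a, b)`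
sum to `1`. [cite: GalesiEtAl2023, Lemmas 12–16 (the substituted parity conditions)] -/
theorem gridRow_holds_iff {n : ℕ} (hn : 1 ≤ n) (hk1 : 1 ≤ k) (hk : 2 * n + 1 ≤ k)
    {f : Fin (k + 1) × Fin (k + 1) → ZMod 2} (htot : ∑ w, dem n f w = 0) (ρ : ℕ → Bool)
    (w : Fin (k + 1) × Fin (k + 1)) :
    (gridSystem k f (Fintype.equivFin _ w)).Holds (blockVals 2 1 _ fun x => (subst n (dem n f) x).eval ρ) ↔
      (if (w.1 : ℕ) % 2 = 1 ∧ (w.1 : ℕ) ≤ 2 * n - 1 ∧ (w.2 : ℕ) % 2 = 1 ∧ (w.2 : ℕ) ≤ 2 * n - 1 then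
        1 + (τN n ρ false (((w.1 : ℕ) - 1) / 2) (((w.2 : ℕ) - 1) / 2) +
          τN n ρ false (predN n (((w.1 : ℕ) - 1) / 2)) (((w.2 : ℕ) - 1) / 2) +
          (τN n ρ true (((w.1 : ℕ) - 1) / 2) (((w.2 : ℕ) - 1) / 2) +
            τN n ρ true (((w.1 : ℕ) - 1) / 2) (predN n (((w.2 : ℕ) - 1) / 2))))
        else (0 : ZMod 2)) = 0 := by
  rw [gridSystem_holds_iff]
  have hy : ∀ ε : GridEdge k, BrickEmbedding.yv (fun x => (subst n (dem n f) x).eval ρ) ε =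
      zv ((edgeForm n (dem n f) ε).eval ρ) := fun ε => by
    rw [BrickEmbedding.yv, subst_gi]; rfl
  simp only [hy]
  rw [rowSum_edgeForm hk1 hk htot ρ w, ← brN_add_cellSum hn, dem]
  constructor
  · intro h
    have h' : f w + (brN n w.1 w.2 + cellSum (τN n ρ) n w.1 w.2) = f w + 0 := by
      rw [add_zero, ← add_assoc]; exact h
    exact add_left_cancel h'
  · intro h
    rw [add_assoc, h, add_zero]

/-- **The torus row behind a torus cell.** For `a, b < n`, the four torus values at `(a, b)` read
off `ρ` sum to `1` iff the torus row of `(a, b)` holds for the block values of `ρ`. [folklore] -/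
theorem torusRow_holds_iff {n : ℕ} {a b : ℕ} (ha : a < n) (hb : b < n) (ρ : ℕ → Bool) :
    (torusSystem n (Fintype.equivFin _ (⟨a, ha⟩, ⟨b, hb⟩))).Holds (blockVals 2 1 _ ρ) ↔
      τN n ρ false a b + τN n ρ false (predN n a) b + (τN n ρ true a b + τN n ρ true a (predN n b)) = 1 := by
  rw [torusSystem_holds_iff]
  have hpa : predN n a < n := by unfold predN; split_ifs <;> omega
  have hpb : predN n b < n := by unfold predN; split_ifs <;> omega
  have hra : (finRotate n).symm ⟨a, ha⟩ = ⟨predN n a, hpa⟩ := Fin.ext (finRotate_symm_eq_predN _)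
  have hrb : (finRotate n).symm ⟨b, hb⟩ = ⟨predN n b, hpb⟩ := Fin.ext (finRotate_symm_eq_predN _)
  have h1 : τN n ρ false a b = zv (ρ (ti n (Sum.inl (⟨a, ha⟩, ⟨b, hb⟩)))) := by
    simp only [τN, ofCode, dif_pos (show a < n ∧ b < n from ⟨ha, hb⟩)]; rfl
  have h2 : τN n ρ false (predN n a) b = zv (ρ (ti n (Sum.inl (⟨predN n a, hpa⟩, ⟨b, hb⟩)))) := by
    simp only [τN, ofCode, dif_pos (show predN n a < n ∧ b < n from ⟨hpa, hb⟩)]; rfl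
  have h3 : τN n ρ true a b = zv (ρ (ti n (Sum.inr (⟨a, ha⟩, ⟨b, hb⟩)))) := by
    simp only [τN, ofCode, dif_pos (show a < n ∧ b < n from ⟨ha, hb⟩)]; rfl
  have h4 : τN n ρ true a (predN n b) = zv (ρ (ti n (Sum.inr (⟨a, ha⟩, ⟨predN n b, hpb⟩)))) := by
    simp only [τN, ofCode, dif_pos (show a < n ∧ predN n b < n from ⟨ha, hpb⟩)]; rfl
  rw [h1, h2, h3, h4, hra, hrb]
  simp only [zv]
  constructor <;> intro h <;> linear_combination h

/-! ### The hypothesis of the transfer lemma -/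

/-- For `n ≥ 2` the two ends of a torus edge are distinct (no loops). [folklore] -/
theorem torusEnds_fst_ne_snd {n : ℕ} (h2 : 2 ≤ n) (e : TorusEdge n) : (torusEnds e).1 ≠ (torusEnds e).2 := by
  -- for `n ≥ 2` the rotation has no fixed point
  -- (cf. `Literature.Computability.AlgebraicComplexity.finRotate_apply_ne`, not imported here)
  have finRotate_ne_self : ∀ a : Fin n, finRotate n a ≠ a := by
    obtain ⟨m, rfl⟩ : ∃ m, n = m + 1 := ⟨n - 1, by omega⟩
    intro a h
    have hv := congrArg Fin.val h
    rw [coe_finRotate] at hv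
    split_ifs at hv with hl
    · rw [hl, Fin.val_last] at hv; omega
    · omega
  rcases e with ⟨a, b⟩ | ⟨a, b⟩
  · simp only [torusEnds_inl, ne_eq, Prod.mk.injEq, and_true]
    exact fun h => finRotate_ne_self a h.symm
  · simp only [torusEnds_inr, ne_eq, Prod.mk.injEq, true_and]
    exact fun h => finRotate_ne_self b h.symm

/-- An edge with an end at `w` is a variable of the torus row of `w` (`n ≥ 2`). [folklore] -/
theorem ti_mem_eqVars {n : ℕ} (h2 : 2 ≤ n) {e : TorusEdge n} {w : Fin n × Fin n}
    (h : (torusEnds e).1 = w ∨ (torusEnds e).2 = w) :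
    ti n e ∈ eqVars 1 (torusSystem n (Fintype.equivFin _ w)) := by
  rw [mem_eqVars]
  refine ⟨Fintype.equivFin _ e, ?_, ?_⟩
  · rw [LinEqMod.supp, Finset.mem_filter, torusSystem_coeff]
    refine ⟨Finset.mem_univ _, ?_⟩
    have hne := torusEnds_fst_ne_snd h2 e
    rcases h with h | h
    · rw [if_pos h, if_neg (fun h' => hne (h.trans h'.symm)), add_zero]; exact one_ne_zero
    · rw [if_neg (fun h' => hne (h'.trans h.symm)), if_pos h, zero_add]; exact one_ne_zero
  · rw [mem_encBlock]
    exact ⟨0, by omega, by simp [ti]⟩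

/-- `predN` rotates back. [folklore] -/
theorem finRotate_predN {n a : ℕ} (ha : a < n) (hp : predN n a < n) :
    finRotate n ⟨predN n a, hp⟩ = ⟨a, ha⟩ := by
  have h : (finRotate n).symm ⟨a, ha⟩ = ⟨predN n a, hp⟩ := Fin.ext (finRotate_symm_eq_predN _)
  rw [← h, Equiv.apply_symm_apply]

/-- **The four grid edges at a torus cell carry the four torus edges at the torus vertex.** At the
cell `(2a+1, 2b+1)` the vertical edges going down / coming from above carry `inl (a, b)` /
`inl (a-1, b)`, the horizontal edges going right / coming from the left carry `inr (a, b)` /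
`inr (a, b-1)`. [cite: Hastad2020, §8 "Final words" ("the vertices of the torus … are mapped
in the natural way")] -/
theorem tedge_at_torusCell {n : ℕ} {a b : ℕ} (ha : a < n) (hb : b < n) (hk : 2 * n + 1 ≤ k)
    {ε : GridEdge k}
    (hε : (gridEnds ε).1 = (⟨2 * a + 1, by omega⟩, ⟨2 * b + 1, by omega⟩) ∨
      (gridEnds ε).2 = (⟨2 * a + 1, by omega⟩, ⟨2 * b + 1, by omega⟩)) :
    ∃ e : TorusEdge n, tedge n ε = some e ∧
      ((torusEnds e).1 = (⟨a, ha⟩, ⟨b, hb⟩) ∨ (torusEnds e).2 = (⟨a, ha⟩, ⟨b, hb⟩)) := by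
  have hpa : predN n a < n := by unfold predN; split_ifs <;> omega
  have hpb : predN n b < n := by unfold predN; split_ifs <;> omega
  rcases ε with ⟨i, c⟩ | ⟨i, c⟩
  · -- horizontal edge `(i, c) — (i, c+1)`
    simp only [gridEnds_inl, Prod.mk.injEq, Fin.ext_iff, Fin.val_succ, Fin.val_castSucc] at hε
    rcases hε with ⟨hi, hc⟩ | ⟨hi, hc⟩
    · -- entering from the left (`c = 2b`): carries `inr (a, b-1)`
      refine ⟨Sum.inr (⟨a, ha⟩, ⟨predN n b, hpb⟩), ?_, Or.inr ?_⟩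
      · have hte : te n (Sum.inl (i, c) : GridEdge k) = some (true, a, predN n b) := by
          show teH n i c = _
          rw [hi, show (c : ℕ) = 2 * b by omega, teH, teV_oddCol (by omega) ha, A_two_mul]; rfl
        rw [tedge, hte, Option.bind_some, ofCode, dif_pos ⟨ha, hpb⟩]; rfl
      · simp only [torusEnds_inr, finRotate_predN hb hpb]
    · -- leaving to the right (`c = 2b+1`): carries `inr (a, b)`
      refine ⟨Sum.inr (⟨a, ha⟩, ⟨b, hb⟩), ?_, Or.inl rfl⟩
      have hte : te n (Sum.inl (i, c) : GridEdge k) = some (true, a, b) := by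
        show teH n i c = _
        rw [hi, show (c : ℕ) = 2 * b + 1 by omega, teH, teV_oddCol (by omega) ha, A_odd]; rfl
      rw [tedge, hte, Option.bind_some, ofCode, dif_pos ⟨ha, hb⟩]; rfl
  · -- vertical edge `(i, c) — (i+1, c)`
    simp only [gridEnds_inr, Prod.mk.injEq, Fin.ext_iff, Fin.val_succ, Fin.val_castSucc] at hε
    rcases hε with ⟨hi, hc⟩ | ⟨hi, hc⟩
    · -- leaving downwards (`i = 2a+1`): carries `inl (a, b)`
      refine ⟨Sum.inl (⟨a, ha⟩, ⟨b, hb⟩), ?_, Or.inl rfl⟩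
      have hte : te n (Sum.inr (i, c) : GridEdge k) = some (false, a, b) := by
        show teV n i c = _
        rw [hi, hc, teV_oddCol (by omega) hb, A_odd]
      rw [tedge, hte, Option.bind_some, ofCode, dif_pos ⟨ha, hb⟩]; rfl
    · -- entering from above (`i = 2a`): carries `inl (a-1, b)`
      refine ⟨Sum.inl (⟨predN n a, hpa⟩, ⟨b, hb⟩), ?_, Or.inr ?_⟩
      · have hte : te n (Sum.inr (i, c) : GridEdge k) = some (false, predN n a, b) := by
          show teV n i c = _
          rw [show (i : ℕ) = 2 * a by omega, hc, teV_oddCol (by omega) hb, A_two_mul]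
        rw [tedge, hte, Option.bind_some, ofCode, dif_pos ⟨hpa, hb⟩]; rfl
      · simp only [torusEnds_inl, finRotate_predN ha hpa]

/-- A clause of the block of a grid row, after the substitution, is true under `ρ` as soon as the
row holds for the induced values. [folklore] -/
theorem substClause_eval {n : ℕ} {dm : Fin (k + 1) × Fin (k + 1) → ZMod 2}
    {f : Fin (k + 1) × Fin (k + 1) → ZMod 2} {r : Fin (Fintype.card (Fin (k + 1) × Fin (k + 1)))}
    {c : Clause ℕ} (hc : c ∈ equationCNF 1 (gridSystem k f r)) (ρ : ℕ → Bool)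
    (h : (gridSystem k f r).Holds (blockVals 2 1 _ fun x => (subst n dm x).eval ρ)) :
    ((KrajicekRamsey.clauseOf c).subst (subst n dm)).eval ρ = true := by
  rw [eval_subst, eval_clauseOf]
  have hcnf : (equationCNF 1 (gridSystem k f r)).eval (fun x => (subst n dm x).eval ρ) = true := by
    rw [eval_equationCNF]; exact decide_eq_true h
  exact (CNF.eval_eq_true_iff _ _).1 hcnf c hc

/-- The variables of a substituted clause of the row of the cell `u` are variables of the
substituted formulas of the edges at `u`. [folklore] -/
theorem mem_vars_substClause {n : ℕ} {dm : Fin (k + 1) × Fin (k + 1) → ZMod 2}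
    {f : Fin (k + 1) × Fin (k + 1) → ZMod 2} {u : Fin (k + 1) × Fin (k + 1)} {c : Clause ℕ}
    (hc : c ∈ equationCNF 1 (gridSystem k f (Fintype.equivFin _ u))) {x : ℕ}
    (hx : x ∈ ((KrajicekRamsey.clauseOf c).subst (subst n dm)).vars) :
    ∃ ε : GridEdge k, ((gridEnds ε).1 = u ∨ (gridEnds ε).2 = u) ∧ x ∈ (edgeForm n dm ε).vars := by
  obtain ⟨y, hy, hxy⟩ := mem_vars_subst hx
  obtain ⟨l, hl, rfl⟩ := mem_vars_clauseOf hy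
  have hl1 : l.1 ∈ eqVars 1 (gridSystem k f _) := fst_mem_of_mem_canonicalCNF hc hl
  obtain ⟨j, hj, hlj⟩ := mem_eqVars.1 hl1
  rw [encBlock_one, List.mem_singleton] at hlj
  obtain ⟨ε, rfl, hε⟩ := exists_of_mem_supp hj
  refine ⟨ε, hε, ?_⟩
  rw [hlj] at hxy
  change x ∈ (subst n dm (gi k ε)).vars at hxy
  rwa [subst_gi] at hxy

/-- **The local data for the transfer lemma.** For every clause `c` of the grid Tseitin formula
`sumEncoding 1 (gridSystem k f)`, the substituted clause `c[σ]` mentions at most `4` torus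
variables and either it is a tautology (cells that are not torus cells: the paths pass, turn or
cross there) or it follows from the `≤ 16` clauses of the block of one torus row over the same
`≤ 4` variables (torus cells). [cite: GalesiEtAl2023, Lemmas 11–16 (the pattern of the reduction);
Hastad2020, §8 (the embedding)] -/
theorem transfer_hloc {n : ℕ} (hn2 : 2 ≤ n) (hk1 : 1 ≤ k) (hk : 2 * n + 1 ≤ k)
    {f : Fin (k + 1) × Fin (k + 1) → ZMod 2} (htot : ∑ w, dem n f w = 0)
    {c : Clause ℕ} (hc : c ∈ sumEncoding 1 (gridSystem k f)) :
    ∃ (Lc : List (Clause ℕ)) (V : List ℕ),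
      (∀ C ∈ Lc, C ∈ sumEncoding 1 (torusSystem n)) ∧ Lc.length ≤ 16 ∧ V.Nodup ∧ V.length ≤ 4 ∧
      (∀ x ∈ ((KrajicekRamsey.clauseOf c).subst (subst n (dem n f))).vars, x ∈ V) ∧
      (∀ C ∈ Lc, ∀ x ∈ (KrajicekRamsey.clauseOf C).vars, x ∈ V) ∧
      ∀ τ : ℕ → Bool, (∀ C ∈ Lc, (KrajicekRamsey.clauseOf C).eval τ = true) →
        ((KrajicekRamsey.clauseOf c).subst (subst n (dem n f))).eval τ = true := by
  classical
  simp only [sumEncoding, List.mem_flatMap, List.mem_finRange, true_and] at hc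
  obtain ⟨r, hc⟩ := hc
  obtain ⟨u, rfl⟩ : ∃ u, r = Fintype.equivFin _ u := ⟨(Fintype.equivFin _).symm r, by simp⟩
  by_cases hbr : (u.1 : ℕ) % 2 = 1 ∧ (u.1 : ℕ) ≤ 2 * n - 1 ∧ (u.2 : ℕ) % 2 = 1 ∧ (u.2 : ℕ) ≤ 2 * n - 1
  · -- a torus cell `(2a+1, 2b+1)`: implied by the block of the torus row of `(a, b)`
    obtain ⟨⟨i, hi⟩, ⟨cc, hcc⟩⟩ := u
    simp only at hbr
    obtain ⟨a, rfl⟩ : ∃ a, i = 2 * a + 1 := ⟨i / 2, by omega⟩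
    obtain ⟨b, rfl⟩ : ∃ b, cc = 2 * b + 1 := ⟨cc / 2, by omega⟩
    have ha : a < n := by omega
    have hb : b < n := by omega
    set w' : Fin n × Fin n := (⟨a, ha⟩, ⟨b, hb⟩) with hw'
    refine ⟨equationCNF 1 (torusSystem n (Fintype.equivFin _ w')),
      eqVars 1 (torusSystem n (Fintype.equivFin _ w')), ?_, ?_, nodup_eqVars _ _, ?_, ?_, ?_, ?_⟩
    · intro C hC
      simp only [sumEncoding, List.mem_flatMap, List.mem_finRange, true_and]
      exact ⟨_, hC⟩
    · refine (length_equationCNF_le 1 _).trans ?_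
      calc 2 ^ ((torusSystem n (Fintype.equivFin _ w')).supp.card * 1) ≤ 2 ^ 4 :=
            Nat.pow_le_pow_right (by norm_num) (by rw [Nat.mul_one]; exact supp_torusSystem_card_le n _)
        _ = 16 := by norm_num
    · rw [length_eqVars, Nat.mul_one]; exact supp_torusSystem_card_le n _
    · intro x hx
      obtain ⟨ε, hε, hxε⟩ := mem_vars_substClause hc hx
      obtain ⟨e, he, rfl⟩ := mem_vars_edgeForm hxε
      obtain ⟨e', he', hends⟩ := tedge_at_torusCell ha hb hk hε
      have hee : e = e' := Option.some.inj (he.symm.trans he')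
      subst hee
      exact ti_mem_eqVars hn2 hends
    · intro C hC x hx
      obtain ⟨l, hl, rfl⟩ := mem_vars_clauseOf hx
      exact fst_mem_of_mem_canonicalCNF hC hl
    · intro τ hτ
      apply substClause_eval hc
      rw [gridRow_holds_iff (by omega) hk1 hk htot τ, if_pos hbr]
      simp only [show (2 * a + 1 - 1) / 2 = a by omega, show (2 * b + 1 - 1) / 2 = b by omega]
      have hrow : (torusSystem n (Fintype.equivFin _ w')).Holds (blockVals 2 1 _ τ) := by
        have hcnf : (equationCNF 1 (torusSystem n (Fintype.equivFin _ w'))).eval τ = true :=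
          (CNF.eval_eq_true_iff _ _).2 fun C hC => by rw [← eval_clauseOf]; exact hτ C hC
        rw [eval_equationCNF] at hcnf
        exact of_decide_eq_true hcnf
      rw [(torusRow_holds_iff ha hb τ).1 hrow]
      decide
  · -- not a torus cell: a tautology
    refine ⟨[], ((leftEdges u ∪ rightEdges u).biUnion fun ε => (edgeForm n (dem n f) ε).vars).toList,
      by simp, by simp, Finset.nodup_toList _, ?_, ?_, by simp, ?_⟩
    · rw [Finset.length_toList]
      calc _ ≤ ∑ ε ∈ leftEdges u ∪ rightEdges u, (edgeForm n (dem n f) ε).vars.card :=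
            Finset.card_biUnion_le
        _ ≤ ∑ _ε ∈ leftEdges u ∪ rightEdges u, 1 :=
            Finset.sum_le_sum fun ε _ => card_vars_edgeForm_le n _ ε
        _ = (leftEdges u ∪ rightEdges u).card := by rw [Finset.sum_const, smul_eq_mul, mul_one]
        _ ≤ (leftEdges u).card + (rightEdges u).card := Finset.card_union_le _ _
        _ ≤ 4 := by have := card_leftEdges_le u; have := card_rightEdges_le u; omega
    · intro x hx
      obtain ⟨ε, hε, hxε⟩ := mem_vars_substClause hc hx
      rw [Finset.mem_toList, Finset.mem_biUnion]
      refine ⟨ε, ?_, hxε⟩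
      rw [Finset.mem_union, leftEdges, rightEdges, Finset.mem_filter, Finset.mem_filter]
      rcases hε with h | h
      · exact Or.inl ⟨Finset.mem_univ _, h⟩
      · exact Or.inr ⟨Finset.mem_univ _, h⟩
    · intro τ _
      apply substClause_eval hc
      rw [gridRow_holds_iff (by omega) hk1 hk htot τ u, if_neg hbr]

/-! ### The torus refutation -/

/-- **From a grid Tseitin formula to the torus contradiction** (`n ≥ 3` odd, `k ≥ 2n+1`). From a
depth-`d` `textbookFrege` proof `π` of `¬ ofCNF (sumEncoding 1 (gridSystem k f))` (any charges `f`: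
a proof exists only for odd total charge) one obtains a depth-`(d + 17)` proof of the negated
Tseitin contradiction of the `n × n` torus of size at most `2^78 (proofSize π + n² + 1)^3`, by the
transfer lemma (GIRS Lemma 10) along the substitution of Håstad's embedding. [cite: Hastad2020,
§8 "Final words" ("the result applies to the grid graph as … it is possible to embed the
n × n torus in a (2n+3) × (2n+2) grid"); GalesiEtAl2023, Lemma 10] -/
theorem exists_torusRefutation {n : ℕ} (hn : Odd n) (hn3 : 3 ≤ n) (hk : 2 * n + 1 ≤ k)
    (f : Fin (k + 1) × Fin (k + 1) → ZMod 2) {d : ℕ} {π : List (PropForm ℕ)}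
    (hπ : textbookFrege.IsDepthProofOf d π (neg (PropForm.ofCNF (sumEncoding 1 (gridSystem k f))))) :
    ∃ π' : List (PropForm ℕ),
      textbookFrege.IsDepthProofOf (d + 17) π' (neg (PropForm.ofCNF (sumEncoding 1 (torusSystem n)))) ∧
      proofSize π' ≤ 2 ^ 78 * (proofSize π + n ^ 2 + 1) ^ 3 := by
  classical
  have hk1 : 1 ≤ k := by omega
  -- a proof of the negation exists, so the system is unsolvable and the total charge is odd
  have hunsat : ¬ SystemSat (gridSystem k f) Finset.univ := by
    intro hsat
    obtain ⟨σ, hσ⟩ := (sumEncoding_satisfiable_iff (p := 2) (B := 1) (by norm_num) one_pos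
      (gridSystem k f)).2 hsat
    have htaut := isSound_textbookFrege.isTautology_of_isProofOf hπ.1 σ
    rw [PropForm.eval, eval_ofCNF, hσ] at htaut
    exact Bool.false_ne_true htaut
  have hf : ∑ w, f w = 1 := sum_charge_eq_one_of_not_systemSat hk1 hunsat
  have htot : ∑ w, dem n f w = 0 := sum_dem hn (by omega) hf
  -- transfer along the substitution
  obtain ⟨π', hπ', hsize⟩ := transfer_isDepthProofOf (sumEncoding 1 (gridSystem k f))
    (sumEncoding 1 (torusSystem n)) (subst n (dem n f)) (Zσ := 2) (Tσ := 1) (qq := 16) (k := 4)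
    (size_subst_le n _) (by norm_num) (altDepthAux_subst_le n _) hπ
    (fun c hc => transfer_hloc (by omega) hk1 hk htot hc)
  refine ⟨π', by rw [show d + 17 = d + 1 + 16 by omega]; exact hπ', hsize.trans ?_⟩
  -- bookkeeping
  set S := proofSize π
  set N' := msum ((sumEncoding 1 (torusSystem n)).map KrajicekRamsey.clauseOf)
  have hN' : N' ≤ 224 * n ^ 2 := msum_torusEncoding_le n
  calc _ ≤ 2 ^ 54 * (S * 2 + N' + 3) ^ 3 := transfer_bound_arith S (S * 2 + N') (by omega)
    _ ≤ 2 ^ 54 * (224 * (S + n ^ 2 + 1)) ^ 3 := by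
        refine Nat.mul_le_mul_left _ (Nat.pow_le_pow_left ?_ 3)
        generalize n ^ 2 = M at *
        omega
    _ ≤ 2 ^ 78 * (S + n ^ 2 + 1) ^ 3 := by
        rw [mul_pow, ← mul_assoc]
        exact Nat.mul_le_mul_right _ (by norm_num)

end TorusEmbedding

/-! ### Presentations of grid Tseitin systems: reduction to the canonical one -/

section Presentation

open GridLabel

variable {k m v : ℕ} {E : Fin m → LinEqMod 2 v}

/-- The row of a grid-presented system, as a sum over the edges at its cell. [folklore] -/
theorem rowSum_of_isGridPresentation (φ : Fin m ≃ Fin (k + 1) × Fin (k + 1)) (ψ : Fin v ≃ GridEdge k)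
    (hE : ∀ i j, (E i).1 j = if φ i = (gridEnds (ψ j)).1 ∨ φ i = (gridEnds (ψ j)).2 then 1 else 0)
    (i : Fin m) (z : Fin v → ZMod 2) :
    ∑ j, (E i).1 j * z j = ∑ ε ∈ leftEdges (φ i), z (ψ.symm ε) + ∑ ε ∈ rightEdges (φ i), z (ψ.symm ε) := by
  rw [← Equiv.sum_comp ψ.symm]
  have h : ∀ ε : GridEdge k, (E i).1 (ψ.symm ε) =
      (if (gridEnds ε).1 = φ i then 1 else 0) + (if (gridEnds ε).2 = φ i then 1 else 0) := by
    intro ε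
    rw [hE, Equiv.apply_symm_apply]
    have hne := gridEnds_fst_ne_snd ε
    by_cases h1 : (gridEnds ε).1 = φ i <;> by_cases h2 : (gridEnds ε).2 = φ i
    · exact absurd (h1.trans h2.symm) hne
    · rw [if_pos (Or.inl h1.symm), if_pos h1, if_neg h2, add_zero]
    · rw [if_pos (Or.inr h2.symm), if_neg h1, if_pos h2, zero_add]
    · rw [if_neg, if_neg h1, if_neg h2, add_zero]
      rintro (h | h)
      · exact h1 h.symm
      · exact h2 h.symm
  simp only [h, add_mul, ite_mul, one_mul, zero_mul, Finset.sum_add_distrib]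
  rw [leftEdges, rightEdges, Finset.sum_filter, Finset.sum_filter]

/-- **Every presentation of a grid Tseitin system reduces to the canonical one.** If
`IsGridTseitinSystem k E` (rows ↔ cells and variables ↔ grid edges by arbitrary bijections, any
charges), then a depth-`d` `textbookFrege` proof `π` of `¬ ofCNF (sumEncoding 1 E)` yields, for the
transported charges `f`, a depth-`(d + 16)` proof of `¬ ofCNF (sumEncoding 1 (gridSystem k f))` of
size at most `2^78 (proofSize π + (k+1)^2 + 1)^3` (transfer along the renaming of the variables).
[cite: GalesiEtAl2023, Lemma 10 (transfer along a substitution; here a renaming)] -/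
theorem exists_gridSystemRefutation (hgrid : IsGridTseitinSystem k E) {d : ℕ} {π : List (PropForm ℕ)}
    (hπ : textbookFrege.IsDepthProofOf d π (neg (PropForm.ofCNF (sumEncoding 1 E)))) :
    ∃ (f : Fin (k + 1) × Fin (k + 1) → ZMod 2) (π' : List (PropForm ℕ)),
      textbookFrege.IsDepthProofOf (d + 16) π' (neg (PropForm.ofCNF (sumEncoding 1 (gridSystem k f)))) ∧
      proofSize π' ≤ 2 ^ 78 * (proofSize π + (k + 1) ^ 2 + 1) ^ 3 := by
  classical
  obtain ⟨φ, ψ, hE⟩ := hgrid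
  set f : Fin (k + 1) × Fin (k + 1) → ZMod 2 := fun w => (E (φ.symm w)).2 with hf
  -- the renaming
  set σ : ℕ → PropForm ℕ := fun x => if h : x < v then .var (gi k (ψ ⟨x, h⟩)) else .var x with hσ
  have hZ : ∀ x, (σ x).size ≤ 1 := fun x => by
    simp only [hσ]; split_ifs <;> simp [PropForm.size]
  have hT : ∀ x c, altDepthAux c (σ x) ≤ 0 := fun x c => by
    simp only [hσ]; split_ifs <;> simp [PropForm.altDepthAux]
  have hloc : ∀ c ∈ sumEncoding 1 E, ∃ (Lc : List (Clause ℕ)) (V : List ℕ),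
      (∀ C ∈ Lc, C ∈ sumEncoding 1 (gridSystem k f)) ∧ Lc.length ≤ 16 ∧ V.Nodup ∧ V.length ≤ 4 ∧
      (∀ x ∈ ((KrajicekRamsey.clauseOf c).subst σ).vars, x ∈ V) ∧
      (∀ C ∈ Lc, ∀ x ∈ (KrajicekRamsey.clauseOf C).vars, x ∈ V) ∧
      ∀ τ : ℕ → Bool, (∀ C ∈ Lc, (KrajicekRamsey.clauseOf C).eval τ = true) →
        ((KrajicekRamsey.clauseOf c).subst σ).eval τ = true := by
    intro c hc
    simp only [sumEncoding, List.mem_flatMap, List.mem_finRange, true_and] at hc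
    obtain ⟨i, hc⟩ := hc
    set w := φ i with hw
    refine ⟨equationCNF 1 (gridSystem k f (Fintype.equivFin _ w)), BrickEmbedding.cellVars k w,
      ?_, ?_, BrickEmbedding.nodup_cellVars k w, BrickEmbedding.length_cellVars_le k w, ?_, ?_, ?_⟩
    · intro C hC
      simp only [sumEncoding, List.mem_flatMap, List.mem_finRange, true_and]
      exact ⟨_, hC⟩
    · refine (length_equationCNF_le 1 _).trans ?_
      calc 2 ^ ((gridSystem k f (Fintype.equivFin _ w)).supp.card * 1) ≤ 2 ^ 4 :=
            Nat.pow_le_pow_right (by norm_num) (by rw [Nat.mul_one]; exact supp_gridSystem_card_le k _ _)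
        _ = 16 := by norm_num
    · intro x hx
      obtain ⟨y, hy, hxy⟩ := mem_vars_subst hx
      obtain ⟨l, hl, rfl⟩ := mem_vars_clauseOf hy
      have hl1 : l.1 ∈ eqVars 1 (E i) := fst_mem_of_mem_canonicalCNF hc hl
      obtain ⟨j, hj, hlj⟩ := mem_eqVars.1 hl1
      rw [encBlock_one, List.mem_singleton] at hlj
      rw [hlj] at hxy
      simp only [hσ, dif_pos j.isLt, Fin.eta, PropForm.vars, Finset.mem_singleton] at hxy
      rw [hxy]
      have hcoef := (Finset.mem_filter.1 hj).2
      rw [hE] at hcoef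
      by_cases h1 : φ i = (gridEnds (ψ j)).1
      · exact BrickEmbedding.gi_mem_cellVars_of_left (by
          rw [leftEdges, Finset.mem_filter]; exact ⟨Finset.mem_univ _, h1.symm⟩)
      · by_cases h2 : φ i = (gridEnds (ψ j)).2
        · exact BrickEmbedding.gi_mem_cellVars_of_right (by
            rw [rightEdges, Finset.mem_filter]; exact ⟨Finset.mem_univ _, h2.symm⟩)
        · exfalso; apply hcoef; rw [if_neg (not_or_intro h1 h2)]
    · intro C hC x hx
      obtain ⟨l, hl, rfl⟩ := mem_vars_clauseOf hx
      have hl1 := fst_mem_of_mem_canonicalCNF hC hl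
      obtain ⟨j, hj, hlj⟩ := mem_eqVars.1 hl1
      rw [encBlock_one, List.mem_singleton] at hlj
      have hcoef := (Finset.mem_filter.1 hj).2
      obtain ⟨ε, rfl⟩ : ∃ ε, j = Fintype.equivFin _ ε := ⟨(Fintype.equivFin _).symm j, by simp⟩
      rw [gridSystem_coeff] at hcoef
      rw [hlj]
      show gi k ε ∈ _
      by_cases h1 : (gridEnds ε).1 = w
      · exact BrickEmbedding.gi_mem_cellVars_of_left (by
          rw [leftEdges, Finset.mem_filter]; exact ⟨Finset.mem_univ _, h1⟩)
      · by_cases h2 : (gridEnds ε).2 = w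
        · exact BrickEmbedding.gi_mem_cellVars_of_right (by
            rw [rightEdges, Finset.mem_filter]; exact ⟨Finset.mem_univ _, h2⟩)
        · exfalso; apply hcoef; rw [if_neg h1, if_neg h2, add_zero]
    · intro τ hτ
      -- the grid block of `w` holds under `τ`, hence the row `E i` holds for the renamed values
      have hcnf : (equationCNF 1 (gridSystem k f (Fintype.equivFin _ w))).eval τ = true :=
        (CNF.eval_eq_true_iff _ _).2 fun C hC => by rw [← eval_clauseOf]; exact hτ C hC
      rw [eval_equationCNF] at hcnf
      have hgridrow := (gridSystem_holds_iff k f w τ).1 (of_decide_eq_true hcnf)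
      have hrow : (E i).Holds (blockVals 2 1 v fun x => (σ x).eval τ) := by
        unfold LinEqMod.Holds
        rw [rowSum_of_isGridPresentation φ ψ hE i]
        have hz : ∀ ε : GridEdge k, blockVals 2 1 v (fun x => (σ x).eval τ) (ψ.symm ε) =
            BrickEmbedding.yv τ ε := fun ε => by
          rw [blockVals_one, BrickEmbedding.yv]
          simp only [hσ, dif_pos (ψ.symm ε).isLt, Fin.eta, Equiv.apply_symm_apply, PropForm.eval]
        simp only [hz]
        rw [hgridrow, hf]
        simp only [hw, Equiv.symm_apply_apply]
      rw [eval_subst, eval_clauseOf]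
      have hcnf' : (equationCNF 1 (E i)).eval (fun x => (σ x).eval τ) = true := by
        rw [eval_equationCNF]; exact decide_eq_true hrow
      exact (CNF.eval_eq_true_iff _ _).1 hcnf' c hc
  obtain ⟨π', hπ', hsize⟩ := transfer_isDepthProofOf (sumEncoding 1 E) (sumEncoding 1 (gridSystem k f)) σ
    (Zσ := 1) (Tσ := 0) (qq := 16) (k := 4) hZ le_rfl hT hπ hloc
  refine ⟨f, π', hπ', hsize.trans ?_⟩
  set S := proofSize π
  set N' := msum ((sumEncoding 1 (gridSystem k f)).map KrajicekRamsey.clauseOf)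
  have hN' : N' ≤ 224 * (k + 1) ^ 2 := msum_gridEncoding_le k _
  calc _ ≤ 2 ^ 54 * (S * 1 + N' + 3) ^ 3 := transfer_bound_arith S (S * 1 + N') (by omega)
    _ ≤ 2 ^ 54 * (224 * (S + (k + 1) ^ 2 + 1)) ^ 3 := by
        refine Nat.mul_le_mul_left _ (Nat.pow_le_pow_left ?_ 3)
        generalize (k + 1) ^ 2 = M at *
        omega
    _ ≤ 2 ^ 78 * (S + (k + 1) ^ 2 + 1) ^ 3 := by
        rw [mul_pow, ← mul_assoc]
        exact Nat.mul_le_mul_right _ (by norm_num)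

end Presentation


/-! ### Assembly: from the torus contradiction to GIRS Theorem 18 -/

open TorusEmbedding

/-- **The canonical grid case from the torus case, depth by depth.** If for some `c > 0`, for every
depth `d` and all large odd `n` every depth-`d` `textbookFrege` proof of the negated Tseitin
contradiction of the `n × n` torus has size `≥ 2^{n^{c/d}}`, then for every `d` and all large `k`
every depth-`d` proof of `¬ ofCNF (sumEncoding 1 (gridSystem k f))` (any charges `f`) has size
`≥ 2^{k^{(c/72)/d}}`: embed the odd torus of side `n = 2⌊(k-3)/4⌋ + 1 ≥ k/4` (`exists_torusRefutation`,
depth `d + 17`, cubic size). [cite: Hastad2020, §8 "Final words" (the grid case from the torus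
case); GalesiEtAl2023, §3.3 (the arithmetic)] -/
theorem gridCanonicalForm_of_torusForm
    (htorus : ∃ c : ℝ, 0 < c ∧ ∀ d : ℕ, ∃ n₁ : ℕ, ∀ n : ℕ, n₁ ≤ n → Odd n →
      ∀ π : List (PropForm ℕ),
        textbookFrege.IsDepthProofOf d π (neg (PropForm.ofCNF (sumEncoding 1 (torusSystem n)))) →
        (2 : ℝ) ^ ((n : ℝ) ^ (c / d)) ≤ (proofSize π : ℝ)) :
    ∃ c : ℝ, 0 < c ∧ ∀ d : ℕ, ∃ k₁ : ℕ, ∀ k : ℕ, k₁ ≤ k →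
      ∀ (f : Fin (k + 1) × Fin (k + 1) → ZMod 2) (π : List (PropForm ℕ)),
        textbookFrege.IsDepthProofOf d π (neg (PropForm.ofCNF (sumEncoding 1 (gridSystem k f)))) →
        (2 : ℝ) ^ ((k : ℝ) ^ (c / d)) ≤ (proofSize π : ℝ) := by
  obtain ⟨c₁, hc₁, htorus⟩ := htorus
  refine ⟨c₁ / 72, by positivity, fun d => ?_⟩
  -- depth 0: there is no depth-0 proof of a negation
  rcases Nat.eq_zero_or_pos d with rfl | hdpos
  · refine ⟨0, ?_⟩
    intro k _ f π hπ
    exfalso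
    have h := hπ.2 _ (List.mem_of_getLast? hπ.1.2)
    simp [PropForm.altDepth, PropForm.altDepthAux] at h
  obtain ⟨n₁, htorus⟩ := htorus (d + 17)
  set D : ℝ := (d : ℝ) + 17 with hD
  set ε : ℝ := c₁ / D with hε
  have hD0 : 0 < D := by positivity
  have hε0 : 0 < ε := by positivity
  set κ : ℝ := (1 / 4 : ℝ) ^ (ε / 2) with hκ
  have hκ0 : 0 < κ := Real.rpow_pos_of_pos (by norm_num) _
  -- thresholds on `n ≥ k/4` and on `k`
  set Qn : ℝ := max (max (n₁ : ℝ) 3) (max ((max 13 (36 / (ε * Real.log 2))) ^ (2 / ε)) ((11 : ℝ) ^ (2 / ε)))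
    with hQn
  set Qk : ℝ := max (max 8 (4 * Qn)) ((1 / κ) ^ (2 / (ε / 2))) with hQk
  refine ⟨⌈Qk⌉₊, ?_⟩
  intro k hk f π hπ
  have hQk' : Qk ≤ k := (Nat.le_ceil Qk).trans (by exact_mod_cast hk)
  have hk8 : (8 : ℝ) ≤ k := ((le_max_left _ _).trans (le_max_left _ _)).trans hQk'
  have hk8' : 8 ≤ k := by exact_mod_cast hk8
  have hkQn : 4 * Qn ≤ k := ((le_max_right _ _).trans (le_max_left _ _)).trans hQk'
  have hkκ : (1 / κ) ^ (2 / (ε / 2)) ≤ k := (le_max_right _ _).trans hQk'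
  -- the odd torus side `n = 2⌊(k-3)/4⌋ + 1`
  set n : ℕ := 2 * ((k - 3) / 4) + 1 with hn
  have hodd : Odd n := ⟨(k - 3) / 4, by rw [hn]⟩
  have h2n : 2 * n + 1 ≤ k := by omega
  have h4n : k ≤ 4 * n := by omega
  have hnk : (k : ℝ) / 4 ≤ n := by
    rw [div_le_iff₀ (by norm_num : (0 : ℝ) < 4)]
    have : (k : ℝ) ≤ 4 * n := by exact_mod_cast h4n
    linarith
  have hQn' : Qn ≤ n := by linarith
  have hn₁ : n₁ ≤ n := by
    have : (n₁ : ℝ) ≤ n := ((le_max_left _ _).trans (le_max_left _ _)).trans hQn'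
    exact_mod_cast this
  have hn3 : (3 : ℝ) ≤ n := ((le_max_right _ _).trans (le_max_left _ _)).trans hQn'
  have hn3' : 3 ≤ n := by exact_mod_cast hn3
  have hnM : (max 13 (36 / (ε * Real.log 2))) ^ (2 / ε) ≤ n :=
    ((le_max_left _ _).trans (le_max_right _ _)).trans hQn'
  have hn11 : (11 : ℝ) ^ (2 / ε) ≤ n := ((le_max_right _ _).trans (le_max_right _ _)).trans hQn'
  have hn0 : (0 : ℝ) < n := by linarith
  have hk0 : (0 : ℝ) < k := by linarith
  have hk1 : (1 : ℝ) ≤ k := by linarith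
  -- the torus refutation and the torus bound
  obtain ⟨π', hπ', hsize⟩ := exists_torusRefutation hodd hn3' h2n f hπ
  have hlow := htorus n hn₁ hodd π' hπ'
  have hA : (2 : ℝ) ^ ((n : ℝ) ^ ε) ≤ 2 ^ (78 : ℕ) * ((proofSize π : ℝ) + (((n : ℝ) + 1) ^ 2 + 1)) ^ 3 := by
    have h1 : (proofSize π' : ℝ) ≤ 2 ^ (78 : ℕ) * ((proofSize π : ℝ) + (n : ℝ) ^ 2 + 1) ^ 3 := by
      exact_mod_cast hsize
    have h2 : (2 : ℝ) ^ ((n : ℝ) ^ ε) ≤ proofSize π' := by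
      have := hlow
      push_cast at this
      rw [hε, hD]
      exact this
    have h3 : ((proofSize π : ℝ) + (n : ℝ) ^ 2 + 1) ^ 3 ≤ ((proofSize π : ℝ) + (((n : ℝ) + 1) ^ 2 + 1)) ^ 3 := by
      apply pow_le_pow_left₀ (by positivity)
      nlinarith
    exact h2.trans (h1.trans (mul_le_mul_of_nonneg_left h3 (by positivity)))
  -- the polynomial term is negligible
  have hP : ((n : ℝ) + 1) ^ 2 + 1 ≤ (2 : ℝ) ^ ((n : ℝ) ^ ε / 3 - 27) :=
    TseitinNumerics.poly_condition hε0 hn3 hnM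
  -- the exponent comparison `k^{(c₁/72)/d} ≤ k^{ε/4} ≤ (k/4)^{ε/2} ≤ n^{ε/2} ≤ n^ε/3 - 27`
  have hγ : c₁ / 72 / (d : ℝ) ≤ ε / 2 / 2 := by
    have hd1 : (1 : ℝ) ≤ d := by exact_mod_cast hdpos
    have e1 : c₁ / 72 / (d : ℝ) = c₁ / (72 * d) := by rw [div_div]
    have e2 : ε / 2 / 2 = c₁ / (4 * ((d : ℝ) + 17)) := by
      rw [hε, hD, div_div, div_div]; congr 1; ring
    rw [e1, e2]
    exact div_le_div_of_nonneg_left hc₁.le (by positivity) (by linarith)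
  have hB : (k : ℝ) ^ (c₁ / 72 / (d : ℝ)) ≤ (n : ℝ) ^ ε / 3 - 27 :=
    calc (k : ℝ) ^ (c₁ / 72 / (d : ℝ)) ≤ (k : ℝ) ^ (ε / 2 / 2) :=
          Real.rpow_le_rpow_of_exponent_le hk1 hγ
      _ ≤ κ * (k : ℝ) ^ (ε / 2) := TseitinNumerics.constant_condition hκ0 (by positivity) hk0 hkκ
      _ = ((k : ℝ) / 4) ^ (ε / 2) := by
          rw [hκ, Real.div_rpow zero_le_one (by norm_num), Real.one_rpow,
            Real.div_rpow hk0.le (by norm_num)]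
          ring
      _ ≤ (n : ℝ) ^ (ε / 2) := Real.rpow_le_rpow (by positivity) hnk (by positivity)
      _ ≤ (n : ℝ) ^ ε / 3 - 27 := TseitinNumerics.half_exponent_condition hε0 hn0 hn11
  -- conclude
  exact TseitinNumerics.size_condition (Nat.cast_nonneg _) (by positivity) hA hP hB

/-- **All presentations from the canonical one, depth by depth**: the grid form (H′) of
`galesiEtAl_tseitin_treewidth_depthFrege_lowerBound_of_grid_of_wall` (every `E` with
`IsGridTseitinSystem n E`) follows from its special case for `gridSystem n f`, with `c/34` for `c`
(`exists_gridSystemRefutation`: a renaming, depth `d + 16`, cubic size). [cite: GalesiEtAl2023,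
§3.3 (the arithmetic)] -/
theorem gridForm_of_gridCanonicalForm
    (hcan : ∃ c : ℝ, 0 < c ∧ ∀ d : ℕ, ∃ k₁ : ℕ, ∀ k : ℕ, k₁ ≤ k →
      ∀ (f : Fin (k + 1) × Fin (k + 1) → ZMod 2) (π : List (PropForm ℕ)),
        textbookFrege.IsDepthProofOf d π (neg (PropForm.ofCNF (sumEncoding 1 (gridSystem k f)))) →
        (2 : ℝ) ^ ((k : ℝ) ^ (c / d)) ≤ (proofSize π : ℝ)) :
    ∃ c : ℝ, 0 < c ∧ ∀ d : ℕ, ∃ n₁ : ℕ, ∀ n : ℕ, n₁ ≤ n →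
      ∀ (m v : ℕ) (E : Fin m → LinEqMod 2 v), IsGridTseitinSystem n E →
      ∀ π : List (PropForm ℕ),
        textbookFrege.IsDepthProofOf d π (neg (PropForm.ofCNF (sumEncoding 1 E))) →
        (2 : ℝ) ^ ((n : ℝ) ^ (c / d)) ≤ (proofSize π : ℝ) := by
  obtain ⟨c₂, hc₂, hcan⟩ := hcan
  refine ⟨c₂ / 34, by positivity, fun d => ?_⟩
  rcases Nat.eq_zero_or_pos d with rfl | hdpos
  · refine ⟨0, ?_⟩
    intro n _ m v E _ π hπ
    exfalso
    have h := hπ.2 _ (List.mem_of_getLast? hπ.1.2)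
    simp [PropForm.altDepth, PropForm.altDepthAux] at h
  obtain ⟨k₁, hcan⟩ := hcan (d + 16)
  set D : ℝ := (d : ℝ) + 16 with hD
  set ε : ℝ := c₂ / D with hε
  have hD0 : 0 < D := by positivity
  have hε0 : 0 < ε := by positivity
  set Q : ℝ := max (max (k₁ : ℝ) 3) (max ((max 13 (36 / (ε * Real.log 2))) ^ (2 / ε)) ((11 : ℝ) ^ (2 / ε)))
    with hQ
  refine ⟨⌈Q⌉₊, ?_⟩
  intro k hk m v E hE π hπ
  have hQ' : Q ≤ k := (Nat.le_ceil Q).trans (by exact_mod_cast hk)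
  have hk₁ : k₁ ≤ k := by
    have : (k₁ : ℝ) ≤ k := ((le_max_left _ _).trans (le_max_left _ _)).trans hQ'
    exact_mod_cast this
  have hk3 : (3 : ℝ) ≤ k := ((le_max_right _ _).trans (le_max_left _ _)).trans hQ'
  have hkM : (max 13 (36 / (ε * Real.log 2))) ^ (2 / ε) ≤ k :=
    ((le_max_left _ _).trans (le_max_right _ _)).trans hQ'
  have hk11 : (11 : ℝ) ^ (2 / ε) ≤ k := ((le_max_right _ _).trans (le_max_right _ _)).trans hQ'
  have hk0 : (0 : ℝ) < k := by linarith
  have hk1 : (1 : ℝ) ≤ k := by linarith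
  obtain ⟨f, π', hπ', hsize⟩ := exists_gridSystemRefutation hE hπ
  have hlow := hcan k hk₁ f π' hπ'
  have hA : (2 : ℝ) ^ ((k : ℝ) ^ ε) ≤ 2 ^ (78 : ℕ) * ((proofSize π : ℝ) + (((k : ℝ) + 1) ^ 2 + 1)) ^ 3 := by
    have h1 : (proofSize π' : ℝ) ≤ 2 ^ (78 : ℕ) * ((proofSize π : ℝ) + ((k : ℝ) + 1) ^ 2 + 1) ^ 3 := by
      exact_mod_cast hsize
    have h2 : (2 : ℝ) ^ ((k : ℝ) ^ ε) ≤ proofSize π' := by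
      have := hlow
      push_cast at this
      rw [hε, hD]
      exact this
    rw [← add_assoc]
    exact h2.trans h1
  have hP : ((k : ℝ) + 1) ^ 2 + 1 ≤ (2 : ℝ) ^ ((k : ℝ) ^ ε / 3 - 27) :=
    TseitinNumerics.poly_condition hε0 hk3 hkM
  have hγ : c₂ / 34 / (d : ℝ) ≤ ε / 2 := by
    have hd1 : (1 : ℝ) ≤ d := by exact_mod_cast hdpos
    have e1 : c₂ / 34 / (d : ℝ) = c₂ / (34 * d) := by rw [div_div]
    have e2 : ε / 2 = c₂ / (2 * ((d : ℝ) + 16)) := by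
      rw [hε, hD, div_div]; congr 1; ring
    rw [e1, e2]
    exact div_le_div_of_nonneg_left hc₂.le (by positivity) (by linarith)
  have hB : (k : ℝ) ^ (c₂ / 34 / (d : ℝ)) ≤ (k : ℝ) ^ ε / 3 - 27 :=
    calc (k : ℝ) ^ (c₂ / 34 / (d : ℝ)) ≤ (k : ℝ) ^ (ε / 2) := Real.rpow_le_rpow_of_exponent_le hk1 hγ
      _ ≤ (k : ℝ) ^ ε / 3 - 27 := TseitinNumerics.half_exponent_condition hε0 hk0 hk11
  exact TseitinNumerics.size_condition (Nat.cast_nonneg _) (by positivity) hA hP hB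

/-- **Håstad's theorem in his own form gives the torus case depth by depth**: (H_T) "there are
`K, c > 0` and `n₀` such that for all odd `n ≥ n₀` and all `d ≤ K log n / log log n`, every depth-`d`
refutation of the Tseitin contradiction of the `n × n` torus has size `≥ 2^{n^{c/d}}`" (Håstad,
JACM 68, Thm. 6.5, with the constants `1/59`, `1/(58(d+1))` and the base `e` absorbed in `K, c, n₀`,
as the `O(1)` depth shifts between Frege formalisms must be anyway) implies the per-depth form used
above, since for fixed `d` the side condition holds for `n ≥ max 16 (exp ((2d/K)^2))`
(`TseitinNumerics.depth_condition`). [cite: Hastad2020, Theorem 6.5] -/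
theorem torusForm_of_hastadTorusForm
    (hT : ∃ K : ℝ, 0 < K ∧ ∃ c : ℝ, 0 < c ∧ ∃ n₀ : ℕ, ∀ n : ℕ, n₀ ≤ n → Odd n → ∀ d : ℕ,
      (d : ℝ) ≤ K * Real.log n / Real.log (Real.log n) →
      ∀ π : List (PropForm ℕ),
        textbookFrege.IsDepthProofOf d π (neg (PropForm.ofCNF (sumEncoding 1 (torusSystem n)))) →
        (2 : ℝ) ^ ((n : ℝ) ^ (c / d)) ≤ (proofSize π : ℝ)) :
    ∃ c : ℝ, 0 < c ∧ ∀ d : ℕ, ∃ n₁ : ℕ, ∀ n : ℕ, n₁ ≤ n → Odd n →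
      ∀ π : List (PropForm ℕ),
        textbookFrege.IsDepthProofOf d π (neg (PropForm.ofCNF (sumEncoding 1 (torusSystem n)))) →
        (2 : ℝ) ^ ((n : ℝ) ^ (c / d)) ≤ (proofSize π : ℝ) := by
  obtain ⟨K, hK, c, hc, n₀, hT⟩ := hT
  refine ⟨c, hc, fun d => ?_⟩
  rcases Nat.eq_zero_or_pos d with rfl | hdpos
  · refine ⟨0, ?_⟩
    intro n _ _ π hπ
    exfalso
    have h := hπ.2 _ (List.mem_of_getLast? hπ.1.2)
    simp [PropForm.altDepth, PropForm.altDepthAux] at h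
  refine ⟨max n₀ ⌈max (16 : ℝ) (Real.exp ((2 * d / K) ^ 2))⌉₊, ?_⟩
  intro n hn hodd π hπ
  have hn₀ : n₀ ≤ n := (le_max_left _ _).trans hn
  have hn' : max (16 : ℝ) (Real.exp ((2 * d / K) ^ 2)) ≤ n := Nat.ceil_le.1 ((le_max_right _ _).trans hn)
  have h16 : (16 : ℝ) ≤ n := (le_max_left _ _).trans hn'
  have hexp : Real.exp ((2 * d / K) ^ 2) ≤ n := (le_max_right _ _).trans hn'
  have hd0 : (0 : ℝ) < d := by exact_mod_cast hdpos
  exact hT n hn₀ hodd d (TseitinNumerics.depth_condition hK hd0 h16 hexp) π hπ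

/-- **The grid form (H′) from Håstad's torus theorem (H_T).** [cite: Hastad2020, Theorem 6.5 and
§8 "Final words"; GalesiEtAl2023, Theorem 17] -/
theorem gridForm_of_hastadTorusForm
    (hT : ∃ K : ℝ, 0 < K ∧ ∃ c : ℝ, 0 < c ∧ ∃ n₀ : ℕ, ∀ n : ℕ, n₀ ≤ n → Odd n → ∀ d : ℕ,
      (d : ℝ) ≤ K * Real.log n / Real.log (Real.log n) →
      ∀ π : List (PropForm ℕ),
        textbookFrege.IsDepthProofOf d π (neg (PropForm.ofCNF (sumEncoding 1 (torusSystem n)))) →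
        (2 : ℝ) ^ ((n : ℝ) ^ (c / d)) ≤ (proofSize π : ℝ)) :
    ∃ c : ℝ, 0 < c ∧ ∀ d : ℕ, ∃ n₁ : ℕ, ∀ n : ℕ, n₁ ≤ n →
      ∀ (m v : ℕ) (E : Fin m → LinEqMod 2 v), IsGridTseitinSystem n E →
      ∀ π : List (PropForm ℕ),
        textbookFrege.IsDepthProofOf d π (neg (PropForm.ofCNF (sumEncoding 1 E))) →
        (2 : ℝ) ^ ((n : ℝ) ^ (c / d)) ≤ (proofSize π : ℝ) :=
  gridForm_of_gridCanonicalForm (gridCanonicalForm_of_torusForm (torusForm_of_hastadTorusForm hT))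

/-- **GIRS Theorem 18 from Håstad's torus theorem and any polynomial excluded-grid theorem (minor
form).** [cite: GalesiEtAl2023, Theorem 18 (proof, §3.3), Theorem 17, Corollary 9; Hastad2020,
Theorem 6.5] -/
theorem galesiEtAl_tseitin_treewidth_depthFrege_lowerBound_of_hastadTorus_of_excludedGrid
    (hT : ∃ K : ℝ, 0 < K ∧ ∃ c : ℝ, 0 < c ∧ ∃ n₀ : ℕ, ∀ n : ℕ, n₀ ≤ n → Odd n → ∀ d : ℕ,
      (d : ℝ) ≤ K * Real.log n / Real.log (Real.log n) →
      ∀ π : List (PropForm ℕ),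
        textbookFrege.IsDepthProofOf d π (neg (PropForm.ofCNF (sumEncoding 1 (torusSystem n)))) →
        (2 : ℝ) ^ ((n : ℝ) ^ (c / d)) ≤ (proofSize π : ℝ))
    (hEG : ∃ δ : ℝ, 0 < δ ∧ ∃ c : ℝ, 0 < c ∧ ∃ t₁ : ℕ, ∀ (V : Type) [Fintype V]
      (G : SimpleGraph V), t₁ ≤ treewidth G →
      ∃ g : ℕ, c * (treewidth G : ℝ) ^ δ ≤ g ∧ grid g g ≼ₘ G) :
    galesiEtAl_tseitin_treewidth_depthFrege_lowerBound :=
  galesiEtAl_tseitin_treewidth_depthFrege_lowerBound_of_grid_of_excludedGrid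
    (gridForm_of_hastadTorusForm hT) hEG

/-- **GIRS Theorem 18 from its two inputs as printed in their primary sources**: Håstad's theorem
for the Tseitin contradiction on the `n × n` torus (JACM 68, Thm. 6.5: `n` odd, all charges `1`,
`d ≤ K log n / log log n`, size `≥ 2^{n^{Ω(1/d)}}`) and Chuzhoy–Tan's Excluded Grid Theorem
(Thm. 1.1: treewidth `≥ c₁ g⁹ log^{c₂} g` forces the `(g × g)`-grid as a minor). Once these two
theorems are in the tree, `galesiEtAl_tseitin_treewidth_depthFrege_lowerBound_holds` is this
theorem applied to them. [cite: GalesiEtAl2023, Theorem 18 (proof, §3.3), Theorem 17, Theorem 8,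
Corollary 9; Hastad2020, Theorem 6.5 and §8 "Final words"; ChuzhoyTan2021, Theorem 1.1] -/
theorem galesiEtAl_tseitin_treewidth_depthFrege_lowerBound_of_hastadTorus_of_chuzhoyTan
    (hT : ∃ K : ℝ, 0 < K ∧ ∃ c : ℝ, 0 < c ∧ ∃ n₀ : ℕ, ∀ n : ℕ, n₀ ≤ n → Odd n → ∀ d : ℕ,
      (d : ℝ) ≤ K * Real.log n / Real.log (Real.log n) →
      ∀ π : List (PropForm ℕ),
        textbookFrege.IsDepthProofOf d π (neg (PropForm.ofCNF (sumEncoding 1 (torusSystem n)))) →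
        (2 : ℝ) ^ ((n : ℝ) ^ (c / d)) ≤ (proofSize π : ℝ))
    (hCT : ∃ c₁ : ℝ, 0 < c₁ ∧ ∃ c₂ : ℝ, 0 < c₂ ∧ ∀ g : ℕ, 2 ≤ g →
      ∀ (V : Type) [Fintype V] (G : SimpleGraph V),
        c₁ * (g : ℝ) ^ 9 * Real.log g ^ c₂ ≤ treewidth G → grid (g - 1) (g - 1) ≼ₘ G) :
    galesiEtAl_tseitin_treewidth_depthFrege_lowerBound :=
  galesiEtAl_tseitin_treewidth_depthFrege_lowerBound_of_hastadTorus_of_excludedGrid hT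
    (excludedGridForm_of_chuzhoyTanForm hCT)

/-- **GIRS Theorem 18 from Håstad's torus theorem and the wall form (W_δ) of the excluded-grid
theorem** (GIRS Cor. 9 with any exponent). [cite: GalesiEtAl2023, Theorem 18, Corollary 9;
Hastad2020, Theorem 6.5] -/
theorem galesiEtAl_tseitin_treewidth_depthFrege_lowerBound_of_hastadTorus_of_wall
    (hT : ∃ K : ℝ, 0 < K ∧ ∃ c : ℝ, 0 < c ∧ ∃ n₀ : ℕ, ∀ n : ℕ, n₀ ≤ n → Odd n → ∀ d : ℕ,
      (d : ℝ) ≤ K * Real.log n / Real.log (Real.log n) →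
      ∀ π : List (PropForm ℕ),
        textbookFrege.IsDepthProofOf d π (neg (PropForm.ofCNF (sumEncoding 1 (torusSystem n)))) →
        (2 : ℝ) ^ ((n : ℝ) ^ (c / d)) ≤ (proofSize π : ℝ))
    (hwall : ∃ δ : ℝ, 0 < δ ∧ ∃ c : ℝ, 0 < c ∧ ∃ t₁ : ℕ, ∀ (V : Type) [Fintype V]
      (G : SimpleGraph V), t₁ ≤ treewidth G →
      ∃ r : ℕ, c * (treewidth G : ℝ) ^ δ ≤ r ∧ wall r ≼ₜ G) :
    galesiEtAl_tseitin_treewidth_depthFrege_lowerBound :=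
  galesiEtAl_tseitin_treewidth_depthFrege_lowerBound_of_grid_of_wall (gridForm_of_hastadTorusForm hT) hwall

end Literature.Computability.MetaComplexity
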